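import Mathlib
import Summits.ValiantsHypothesis.ValiantsHypothesis.Theses.ValuativeGCT

/-!
# Disproof of `CutBites` — findings (standing disprover, gen 2; §G–§I added by gen 3)

Crux `stmt-ValiantsHypothesis-12626` = `Summit.ValiantsHypothesis.ValiantsHypothesis.Theses.ValuativeGCT.CutBites`
(route ValuativeGCT, rank 4): for every odd `m ≥ 3` there are `δ` and `λ ⊢ mδ` (`≤ m²` parts) with
`finrank T_Λ(δ, λ*) < finrank T_Λ(0, λ*)`, where `T_Λ(t, λ*)` = degree-`mδ` polynomials on
`End(ℂ^{m×m})` lying in `P_Λ^t` (`P_Λ` = vanishing ideal of `L_Λ` = {all rows skew}), right-invariant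
under the `End`-stabiliser `H` of `det_m` (`A ↦ AM`, `linSubst M det_m = det_m`), and `B`-semi-invariant
of weight `λ* = (dualOfPartition (m*m) λ).toMatIdx` for the upper-triangular Borel acting by
`G ↦ G(g⁻¹A)`.

## VERDICT (this seat, agreeing with rattack-12626, rreview ×2, cdisprove gen 1, three ideators)
**The crux is TRUE; no counterexample exists.**  It resists disproof because for odd `m` the skew
space `Λ_m` has an Edmonds gap (`rk = m-1 < ncrk = m`): some `2 × 2` blow-up `det(∑ T_j ⊗ X_j)` is
non-zero on a skew tuple (the `H°`-invariant `f_T + f_{Tᵀ}` then has `L_Λ`-order `0 < 2 = δ`), and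
`L_Λ` is left-`GL_{m²}`-stable, so some highest-weight vector of the (semisimple) `GL_{m²}`-module
`ℂ[End W]^H_{2m}` lies outside `P_Λ ⊇ P_Λ²` (§B below is the last step of that argument, in Lean).
Independent second mechanism: the Plücker point `∧Λ_m ∈ Λ^{m(m-1)/2}(ℂ^m ⊗ ℂ^m)` has scalar
one-body marginals, hence is Kempf–Ness critical, hence `SL_m × SL_m`-polystable, so a rectangular
weight `(c^{m(m-1)/2})` is cut (card grassmann-point-stability; verified here on paper: marginals
`ρ_E = ρ_F = (m-1)·𝟙`, `ρ_U = 2·𝟙`).  The provers' only non-elementary input is Frobenius 1897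
(`H ⊆ {X ↦ PXQ, PXᵀQ}`), now a named fact in tree:
`Literature.NumberTheory.DiophantineGeometry.frobenius_detPreserver_unimodular_sandwich`.

## LANDED IN TREE (importable; `Summits.ValiantsHypothesis.ValiantsHypothesis.Theorems.CutBites.Negative.*`,
namespace `Summit.ValiantsHypothesis.ValiantsHypothesis.Theorems.CutBites.Negative`, statements over the
crux's literal `let`-blocks): `NoCutInOddDegree` (§C: `cutBites_trunc_one_eq_trunc_zero_of_odd`,
`cutBites_no_witness_at_delta_one`), `CutBitesFalseWithoutThreeLe` (§A), `NonVacuity` (§D: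
`cutBites_detRowLast_pow_mem_trunc_zero`, `cutBites_trunc_zero_ne_bot`,
`cutBites_detRowLast_pow_mem_trunc_delta_of_odd`), `NoCutForColumnCompression` (§F:
`cutBites_truncCol_eq`, `cutBites_false_for_every_rank_bounded_space`); gen 3: `EvenDegreeOrderParity`
(§G.1: `mem_vanishingIdeal_sq_of_even_of_rowTranspose_invariant`, `cutBites_trunc_two_eq_trunc_one_of_even`,
`cutBites_trunc_firstRung_two_eq_one`), `NoCutAtSecondStep` (§G.1: `cutBites_no_strict_second_step`,
`cutBites_finrank_lt_of_witness`, `cutBites_firstRung_lt_iff_witness`), `LeftSLInvariantsDetPow` (§I.2–3: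
`linSubst_leftMul_detFormLex`, `eval_linSubst_leftMul`, `linSubst_eq_of_rename_rowAct_invariant`,
`eq_C_mul_detFormLex_pow_of_leftSL_invariant`), `OneRowWeightNeverCut` (§I.1, §I.4:
`vars_subset_lastRow_of_oneRow_semiInvariant`, `cutBites_trunc_zero_oneRow_eq_span`,
`cutBites_finrank_trunc_zero_oneRow`, `cutBites_trunc_oneRow_eq_of_odd`, `cutBites_no_cut_at_oneRow_weight`);
`NormalOrderParityLaw` (§G.2: `mem_vanishingIdeal_pow_succ_of_odd_add_of_rowTranspose_invariant`),
`NoJumpAtWrongParity` (§G.2: `cutBites_trunc_succ_eq_of_odd_add`, `cutBites_trunc_eq_pred_of_odd`,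
`cutBites_trunc_even_degree_odd_threshold`, `cutBites_trunc_odd_degree_even_threshold`) — all ACCEPTED.

## CONTENTS (all `sorry`-free; no NEAR-MISS section needed — nothing resisted)
* §0 `truncU` / `trunc` unbundle the crux's inlined `T`; `cutBites_iff` is `Iff.rfl`.
* §B CUT CRITERION `finrank_lt_of_eval_ne_zero`: `G ∈ T(0)` + one non-zero value on `L_U` ⇒
  `finrank T(t) < finrank T(0)` for every `t ≥ 1`; `cutBites_of_witness` (what every line must supply).
* §A LOAD-BEARING `3 ≤ m`: `cutBites_false_without_three_le` — dropping `3 ≤ m` makes the crux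
  FALSE (`m = 1`: `Λ_1 = 0`, `Hom_δ ⊆ 𝔪^δ`, so `T(δ) = T(0)` for every `δ, λ`).
  `Odd m` is NOT load-bearing for truth (even `m`: `det(X_N)^δ` has `L_Λ`-order `0`; §E),
  it fixes the meaning (threshold `δ(m - r)`, `r = m - 1`).  `λ.parts.card ≤ m*m` is hygiene only
  (a truncated weight has the wrong size, `T(0) = ⊥`).
* §C PARITY `truncSkew_one_eq_zero_of_odd`: if `mδ` is odd then `T_Λ(1) = T_Λ(0)` for EVERY weight
  (the transposition `M_τ ∈ H` negates skew rows), hence `not_cutBitesAtDeltaOne`: the natural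
  strengthening "the cut already bites in degree `m` (`δ = 1`)" is FALSE for every odd `m`;
  `δ = 2` is the first rung and is attained (evidence of the earlier seats).
* §D NON-VACUITY + MEMBERSHIP TEMPLATES `detRow_pow_mem_trunc_zero` / `trunc_zero_ne_bot`:
  `det_m(last row)^δ ∈ T(0)` at `λ = (mδ)` — the crux's weight/dual/Borel/`g⁻¹` conventions fit
  (weight `-mδ` on the LAST lex index); for odd `m` also `∈ T(δ)` (`detRow_pow_mem_trunc_delta_of_odd`):
  the obvious invariant never witnesses the cut.  `aeval_rowAct_rename`, `aeval_borelAct_detRow_jTop`,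
  `aeval_smul_X_of_isHomogeneous` are the reusable membership templates.
* §E `Odd m` NOT load-bearing for truth: `cutBites_conclusion_at_four` — at the even `m = 4` the
  conclusion holds (δ = 1, λ = (4), det₄(last row), all rows = J₄).  Truth table of the conclusion
  over all `m`: `m = 1` false (§A); even `m` true (here `m = 4`; general even `m` identical with
  `J_m`); odd `m ≥ 3` true on paper (δ = 2, item evidence) — so exactly `3 ≤ m` (i.e. `m ≠ 1`) matters.
* §G PARITY OF THE NORMAL ORDER (gen 3) `mem_vanI_sq_of_even` / `truncSkew_two_eq_one_of_even`:
  in EVEN degree every `H`-invariant form vanishing on `L_Λ` vanishes to order `≥ 2`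
  (`G(S+N) = G(S-N)` by `M_τ ∈ H`; skew/symmetric coordinates `kappa`/`theta`), so `T_Λ(2) = T_Λ(1)`
  for every `m`, every even `D`, every weight — companion of §C (odd `D`: `T_Λ(1) = T_Λ(0)`).  At the
  FIRST RUNG `δ = 2` (`D = 2m`): `trunc_firstRung_two_eq_one`; the strengthening "`T(2) < T(1)`" is
  FALSE (`not_cutBitesStrictSecondStep`); and `firstRung_lt_iff_witness` / `cutBites_firstRung_iff`:
  `finrank T(2) < finrank T(0)` IFF some `G ∈ T(0)` is non-zero somewhere on `L_Λ` — the witness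
  shape of §B is NECESSARY at `δ = 2`, the threshold is immaterial there (all three registered lines
  — pencil-degree-frobenius, pfaffian-square-address at `δ = 2`, adjugate-pfaffian-kernel at
  `δ = m-1` — already argue through an order-`0` witness, consistently).
* §G.2 FULL PARITY LAW (gen 3) `mem_vanI_pow_iff_le_nDeg` / `truncSkew_succ_eq_of_odd_add`: `P_Λ^t` = forms
  whose skew/symmetric monomials have `n`-degree `≥ t` (κ/θ inverse automorphisms, `κ(P_Λ) ⊆ (n)`,
  monomial-ideal powers by induction), hence `T_Λ(t+1) = T_Λ(t)` WHENEVER `t + D` IS ODD (every `m`, `t`,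
  weight): the valuative filtration of `Λ_m` jumps only at orders `≡ D (mod 2)`; crux corollaries
  `trunc_eq_pred_of_odd` (odd `m`, odd `δ`: `T(δ) = T(δ-1)`), `trunc_even_degree_odd_threshold`,
  `trunc_odd_degree_even_threshold`.
* §H STUB AUDIT (gen 3): all 18 stubs of the three registered lines are true as typed (paper + exact toy
  `toy/check_stubs.py`); ERRATUM for the adjugate line: `Odd m` is NOT load-bearing for its stub 6
  (`adjDetTwo_ne_zero_at_skewPoint`: `W_2 = 4 ≠ 0` at a skew point).  No `-- Targets` (no stuck stubs yet).
* §I ONE-ROW WEIGHTS NEVER CUT (gen 3): `trunc_zero_rowPartition_eq_span` — `T_0((mδ)) = ℂ·det_m(last row)^δ`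
  for every `m ≥ 1`, `δ ≥ 1` (torus ⇒ last-row polynomial; `Mleft P ∈ Stab` ⇒ left-`SL_m`-invariant;
  `eq_C_mul_detFormLex_pow`: `SL_m`-invariant forms of degree `mδ` are `c·det^δ`), so
  `finrank_trunc_zero_rowPartition = 1` (first exact dimension of a truncation space), and for odd `m`
  `trunc_rowPartition_eq_zero_of_odd`: `T(t) = T(0)` at `λ = (mδ)` for all `t ≤ δ` —
  `not_cutBitesAtOneRowWeight`: the strengthening "some one-row weight is cut" is FALSE; a cut (and a
  flip) must live on shapes with `≥ 2` rows.  §I.5 contrast: for EVEN `m = 4` the one-row weight is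
  TOTALLY cut (`T(t) = ⊥`, `t ≥ 1`; `finrank 0 < 1`) — at `λ = (mδ)` the conclusion is exactly the parity of `m`.
  §I.6 remark (paper + toy `check_pairs_nullcone.py`): TWO-row weights are never cut either (pair invariants =
  polarisations of `det`, all `0` on odd skew pairs); the cut index is exactly `3` rows for every odd `m`.
* §F NO EDMONDS GAP ⇒ NO CUT: `truncU_colU_eq` — for the compression space `U_col = {column 0 = 0}`
  (rank `m-1`, `rk = ncrk`) the truncation at the route threshold `δ(m-r) = δ` is VACUOUS for every
  `m ≥ 1`, `δ`, `λ` (torus element `M_q ∈ Stab`, `linSubst_Mq_detFormLex`; every monomial of an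
  invariant has column-0 degree exactly `δ`); hence `not_cutBitesEveryRankBoundedSpace`: "every
  non-zero singular space of rank ≤ r < m cuts at δ(m-r)" is FALSE (m = 3, U_col, r = 2).  The
  Edmonds gap of `Λ_m` is exactly what the crux uses.
-/

namespace Summit.ValiantsHypothesis.ValiantsHypothesis.Cruxes.CutBites.Disproof

open Literature.NumberTheory.DiophantineGeometry Literature.Computability.AlgebraicComplexity
open MvPolynomial
open scoped BigOperators Matrix

set_option linter.dupNamespace false

noncomputable section

/-! ## §0 Unbundling the crux -/

/-- Index type of the coordinates `A (j, i)` of `End(ℂ^{m×m})` (row `j`, column `i`). -/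
abbrev Idx (m : ℕ) : Type := MatIdx m × MatIdx m

/-- The skew-symmetric Edmonds-gap space `Λ_m` — verbatim the crux's `U`. -/
def skewU (m : ℕ) : Submodule ℂ (MatIdx m → ℂ) :=
  Submodule.span ℂ {u : MatIdx m → ℂ | ∀ a b : Fin m, u (toLex (a, b)) = -u (toLex (b, a))}

/-- `L_U = {A : every row of A lies in U}` — verbatim the crux's point set. -/
def locus (m : ℕ) (U : Submodule ℂ (MatIdx m → ℂ)) : Set (Idx m → ℂ) :=
  {p : Idx m → ℂ | ∀ j : MatIdx m, (fun i => p (j, i)) ∈ U}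

/-- `P_U`, the vanishing ideal of `L_U`. -/
def vanI (m : ℕ) (U : Submodule ℂ (MatIdx m → ℂ)) : Ideal (MvPolynomial (Idx m) ℂ) :=
  MvPolynomial.vanishingIdeal ℂ (locus m U)

/-- Right invariance under the `End`-stabiliser of `det_m` — verbatim the crux's third factor. -/
def stabInv (m : ℕ) : Submodule ℂ (MvPolynomial (Idx m) ℂ) :=
  ⨅ (M : Matrix (MatIdx m) (MatIdx m) ℂ)
    (_ : linSubst (MatIdx m) ℂ M (detFormLex ℂ m) = detFormLex ℂ m),
    LinearMap.ker ((MvPolynomial.aeval (R := ℂ) fun p : Idx m =>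
      ∑ l : MatIdx m, M l p.2 • MvPolynomial.X (p.1, l)).toLinearMap
      - LinearMap.id (R := ℂ) (M := MvPolynomial (Idx m) ℂ))

/-- Left `B`-semi-invariance of weight `χ` — verbatim the crux's fourth factor. -/
def hwSp (m : ℕ) (χ : Weight (MatIdx m)) : Submodule ℂ (MvPolynomial (Idx m) ℂ) :=
  ⨅ (g : Matrix.GeneralLinearGroup (MatIdx m) ℂ) (_ : IsUpperTriangular g),
    LinearMap.ker ((MvPolynomial.aeval (R := ℂ) fun p : Idx m =>
      ∑ l : MatIdx m, ((g⁻¹ : Matrix.GeneralLinearGroup (MatIdx m) ℂ) :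
        Matrix (MatIdx m) (MatIdx m) ℂ) p.1 l • MvPolynomial.X (l, p.2)).toLinearMap
      - weightChar χ g • LinearMap.id (R := ℂ) (M := MvPolynomial (Idx m) ℂ))

/-- The truncation in degree `D`, for a row space `U`, weight `χ`, threshold `t`. -/
def truncU (m D : ℕ) (U : Submodule ℂ (MatIdx m → ℂ)) (χ : Weight (MatIdx m)) (t : ℕ) :
    Submodule ℂ (MvPolynomial (Idx m) ℂ) :=
  MvPolynomial.homogeneousSubmodule (Idx m) ℂ D ⊓ ((vanI m U) ^ t).restrictScalars ℂ
    ⊓ stabInv m ⊓ hwSp m χ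

/-- The crux's `T t` at `(m, δ, λ)`: `truncU` at `D = mδ`, `U = Λ_m`, `χ = λ*`. -/
def trunc (m δ : ℕ) (lam : Nat.Partition (m * δ)) (t : ℕ) : Submodule ℂ (MvPolynomial (Idx m) ℂ) :=
  truncU m (m * δ) (skewU m) (Weight.dualOfPartition (m * m) lam).toMatIdx t

/-- The crux, unbundled (definitional). -/
theorem cutBites_iff :
    Theses.ValuativeGCT.CutBites ↔
      ∀ m : ℕ, Odd m → 3 ≤ m → ∃ (δ : ℕ) (lam : Nat.Partition (m * δ)),
        lam.parts.card ≤ m * m ∧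
          Module.finrank ℂ ↥(trunc m δ lam δ) < Module.finrank ℂ ↥(trunc m δ lam 0) :=
  Iff.rfl

/-! ## §B The cut criterion (bookkeeping every line needs) -/

section Criterion

variable {m D : ℕ} {U : Submodule ℂ (MatIdx m → ℂ)} {χ : Weight (MatIdx m)}

/-- `t ↦ T(t)` is antitone. -/
theorem truncU_anti {s t : ℕ} (h : s ≤ t) : truncU m D U χ t ≤ truncU m D U χ s := by
  unfold truncU
  exact inf_le_inf_right _ (inf_le_inf_right _ (inf_le_inf_left _
    (Submodule.restrictScalars_mono ℂ (Ideal.pow_le_pow_right h))))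

/-- `T(t) ≤ T(0)`. -/
theorem truncU_le_zero (t : ℕ) : truncU m D U χ t ≤ truncU m D U χ 0 :=
  truncU_anti (Nat.zero_le t)

/-- `T(0)` is the degree piece cut by the two invariance conditions only (`P^0 = ⊤`). -/
theorem truncU_zero :
    truncU m D U χ 0 =
      MvPolynomial.homogeneousSubmodule (Idx m) ℂ D ⊓ stabInv m ⊓ hwSp m χ := by
  unfold truncU
  rw [pow_zero, Ideal.one_eq_top, Submodule.restrictScalars_top, inf_top_eq]

/-- Every `T(t)` is finite-dimensional (it sits in one graded piece). -/
instance finiteDimensional_truncU (t : ℕ) : FiniteDimensional ℂ ↥(truncU m D U χ t) := by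
  have : Module.Finite ℂ ↥(MvPolynomial.homogeneousSubmodule (Idx m) ℂ D) :=
    Module.Finite.iff_fg.mpr (MvPolynomial.homogeneousSubmodule_fg (Idx m) ℂ D)
  have hle : truncU m D U χ t ≤ MvPolynomial.homogeneousSubmodule (Idx m) ℂ D := by
    unfold truncU
    exact inf_le_left.trans (inf_le_left.trans inf_le_left)
  exact Submodule.finiteDimensional_of_le hle

/-- For `t ≥ 1`, `T(t) ≤ P_U`. -/
theorem truncU_le_vanI {t : ℕ} (ht : 0 < t) :
    truncU m D U χ t ≤ (vanI m U).restrictScalars ℂ := by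
  unfold truncU
  refine inf_le_left.trans (inf_le_left.trans (inf_le_right.trans ?_))
  exact Submodule.restrictScalars_mono ℂ ((Ideal.pow_le_pow_right ht).trans_eq (pow_one _))

/-- For `t ≥ 1`, elements of `T(t)` vanish on `L_U`. -/
theorem eval_eq_zero_of_mem_truncU {t : ℕ} (ht : 0 < t) {G : MvPolynomial (Idx m) ℂ}
    (hG : G ∈ truncU m D U χ t) {p : Idx m → ℂ} (hp : p ∈ locus m U) :
    MvPolynomial.eval p G = 0 := by
  have h := truncU_le_vanI ht hG
  rw [Submodule.restrictScalars_mem, vanI, mem_vanishingIdeal_iff] at h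
  simpa [MvPolynomial.coe_aeval_eq_eval] using h p hp

/-- **Cut criterion.** An element of `T(0)` with one non-zero value on `L_U` forces
`finrank T(t) < finrank T(0)` for every threshold `t ≥ 1`. -/
theorem finrank_lt_of_eval_ne_zero {t : ℕ} (ht : 0 < t) {G : MvPolynomial (Idx m) ℂ}
    (hG : G ∈ truncU m D U χ 0) {p : Idx m → ℂ} (hp : p ∈ locus m U)
    (hGp : MvPolynomial.eval p G ≠ 0) :
    Module.finrank ℂ ↥(truncU m D U χ t) < Module.finrank ℂ ↥(truncU m D U χ 0) := by
  refine Submodule.finrank_lt_finrank_of_lt (lt_of_le_of_ne (truncU_le_zero t) fun h => hGp ?_)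
  have hG' : G ∈ truncU m D U χ t := by rw [h]; exact hG
  exact eval_eq_zero_of_mem_truncU ht hG' hp

/-- Conversely, with no cut (`T(t) = T(0)`, `t ≥ 1`) every element of `T(0)` vanishes on `L_U`. -/
theorem eval_eq_zero_of_truncU_eq {t : ℕ} (ht : 0 < t) (h : truncU m D U χ t = truncU m D U χ 0)
    {G : MvPolynomial (Idx m) ℂ} (hG : G ∈ truncU m D U χ 0) {p : Idx m → ℂ}
    (hp : p ∈ locus m U) : MvPolynomial.eval p G = 0 :=
  eval_eq_zero_of_mem_truncU ht (h ▸ hG : G ∈ truncU m D U χ t) hp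

end Criterion

/-- **What every proving line must supply** (cards pfaffian-square-address,
adjugate-pfaffian-kernel, grassmann-point-stability, staircase-quadric all reduce to this):
for each odd `m ≥ 3` one `δ ≥ 1`, one `λ`, one `G ∈ T(0)` and one point of `L_Λ` where `G ≠ 0`. -/
theorem cutBites_of_witness
    (h : ∀ m : ℕ, Odd m → 3 ≤ m → ∃ (δ : ℕ) (lam : Nat.Partition (m * δ)),
      0 < δ ∧ lam.parts.card ≤ m * m ∧
        ∃ G ∈ trunc m δ lam 0, ∃ p ∈ locus m (skewU m), MvPolynomial.eval p G ≠ 0) :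
    Theses.ValuativeGCT.CutBites := by
  rw [cutBites_iff]
  intro m hm h3
  obtain ⟨δ, lam, hδ, hcard, G, hG, p, hp, hGp⟩ := h m hm h3
  exact ⟨δ, lam, hcard, finrank_lt_of_eval_ne_zero hδ hG hp hGp⟩

/-! ## §A `3 ≤ m` is load-bearing: the crux without it is false at `m = 1` -/

/-- The crux with the hypothesis `3 ≤ m` dropped. -/
def CutBitesWithoutThreeLe : Prop :=
  ∀ m : ℕ, Odd m → ∃ (δ : ℕ) (lam : Nat.Partition (m * δ)), lam.parts.card ≤ m * m ∧
    Module.finrank ℂ ↥(trunc m δ lam δ) < Module.finrank ℂ ↥(trunc m δ lam 0)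

/-- `Λ_1 = 0`: a `1 × 1` skew matrix vanishes. -/
theorem skewU_one : skewU 1 = ⊥ := by
  rw [skewU, Submodule.span_eq_bot]
  intro u hu
  funext i
  have h := hu 0 0
  have hi : i = toLex ((0 : Fin 1), (0 : Fin 1)) :=
    congrArg toLex (Subsingleton.elim (ofLex i) ((0 : Fin 1), (0 : Fin 1)))
  rw [hi]
  have h0 : u (toLex ((0 : Fin 1), (0 : Fin 1))) = 0 := by linear_combination h / 2
  simpa using h0

/-- At `m = 1` every coordinate function vanishes on `L_Λ = {0}`. -/
theorem X_mem_vanI_one (v : Idx 1) : (X v : MvPolynomial (Idx 1) ℂ) ∈ vanI 1 (skewU 1) := by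
  rw [vanI, mem_vanishingIdeal_iff]
  intro p hp
  have h := hp v.1
  rw [skewU_one, Submodule.mem_bot] at h
  have : p (v.1, v.2) = 0 := by simpa using congr_fun h v.2
  simpa using this

/-- At `m = 1`, `Hom_δ ⊆ P_Λ^δ` (`P_Λ` is the irrelevant ideal). -/
theorem homogeneous_le_vanI_pow_one (δ : ℕ) :
    MvPolynomial.homogeneousSubmodule (Idx 1) ℂ δ ≤ ((vanI 1 (skewU 1)) ^ δ).restrictScalars ℂ := by
  intro φ hφ
  rw [Submodule.restrictScalars_mem, φ.as_sum]
  refine Ideal.sum_mem _ fun d hd => ?_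
  rw [MvPolynomial.monomial_eq]
  refine Ideal.mul_mem_left _ _ ?_
  have hdeg : (∑ i ∈ d.support, d i) = δ := by
    have := hφ (mem_support_iff.mp hd)
    simpa [Finsupp.weight_apply, Finsupp.sum] using this
  rw [Finsupp.prod, ← hdeg, ← Finset.prod_pow_eq_pow_sum]
  exact Ideal.prod_mem_prod fun i _ => Ideal.pow_mem_pow (X_mem_vanI_one i) _

/-- At `m = 1` the truncation never cuts: `T(δ) = T(0)` for every `δ` and every weight. -/
theorem trunc_one_eq (δ : ℕ) (lam : Nat.Partition (1 * δ)) : trunc 1 δ lam δ = trunc 1 δ lam 0 := by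
  have key : MvPolynomial.homogeneousSubmodule (Idx 1) ℂ (1 * δ)
        ⊓ ((vanI 1 (skewU 1)) ^ δ).restrictScalars ℂ
      = MvPolynomial.homogeneousSubmodule (Idx 1) ℂ (1 * δ)
        ⊓ ((vanI 1 (skewU 1)) ^ 0).restrictScalars ℂ := by
    rw [pow_zero, Ideal.one_eq_top, Submodule.restrictScalars_top, inf_top_eq, one_mul]
    exact inf_eq_left.mpr (homogeneous_le_vanI_pow_one δ)
  unfold trunc truncU
  rw [key]

/-- **`3 ≤ m` is load-bearing.**  Any proof of the crux must use `3 ≤ m` (in fact `m ≠ 1`):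
with it dropped the statement fails at the odd number `m = 1`. -/
theorem cutBites_false_without_three_le : ¬ CutBitesWithoutThreeLe := by
  intro h
  obtain ⟨δ, lam, -, hlt⟩ := h 1 odd_one
  rw [trunc_one_eq] at hlt
  exact lt_irrefl _ hlt

/-! ## §C Parity: no cut at threshold 1 when `mδ` is odd (so never at `δ = 1` for odd `m`) -/

section Parity

variable {m : ℕ}

/-- Evaluation of a homogeneous polynomial at a rescaled point. -/
theorem eval_smul_of_isHomogeneous {σ : Type*} {φ : MvPolynomial σ ℂ} {n : ℕ}
    (hφ : φ.IsHomogeneous n) (c : ℂ) (x : σ → ℂ) :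
    MvPolynomial.eval (c • x) φ = c ^ n * MvPolynomial.eval x φ := by
  rw [MvPolynomial.eval_eq, MvPolynomial.eval_eq, Finset.mul_sum]
  refine Finset.sum_congr rfl fun d hd => ?_
  have hdeg : (∑ i ∈ d.support, d i) = n := by
    have := hφ (mem_support_iff.mp hd)
    simpa [Finsupp.weight_apply, Finsupp.sum] using this
  simp only [Pi.smul_apply, smul_eq_mul, mul_pow, Finset.prod_mul_distrib,
    Finset.prod_pow_eq_pow_sum, hdeg]
  ring

/-- Vectors in `Λ_m = span {skew}` are skew (the generating set is a subspace). -/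
theorem skew_of_mem_skewU {u : MatIdx m → ℂ} (hu : u ∈ skewU m) (a b : Fin m) :
    u (toLex (a, b)) = -u (toLex (b, a)) := by
  induction hu using Submodule.span_induction generalizing a b with
  | mem x hx => exact hx a b
  | zero => simp
  | add x y _ _ hx hy => rw [Pi.add_apply, Pi.add_apply, hx, hy]; ring
  | smul c x _ hx => rw [Pi.smul_apply, Pi.smul_apply, hx]; simp

/-- Transposition of the matrix index, `(a, b) ↦ (b, a)`. -/
def swapIdx (m : ℕ) (i : MatIdx m) : MatIdx m := toLex ((ofLex i).2, (ofLex i).1)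

@[simp] theorem swapIdx_toLex (a b : Fin m) : swapIdx m (toLex (a, b)) = toLex (b, a) := rfl

/-- The permutation matrix `M_τ` of the transposition `X ↦ Xᵀ` of `ℂ^{m×m}`. -/
def Mtau (m : ℕ) : Matrix (MatIdx m) (MatIdx m) ℂ :=
  Matrix.of fun l i => if l = swapIdx m i then 1 else 0

theorem sum_Mtau_smul {N : Type*} [AddCommMonoid N] [Module ℂ N] (f : MatIdx m → N) (i : MatIdx m) :
    ∑ l : MatIdx m, Mtau m l i • f l = f (swapIdx m i) := by
  simp [Mtau, Matrix.of_apply, ite_smul, Finset.sum_ite_eq']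

/-- `linSubst M_τ` is the renaming of variables along the index transposition. -/
theorem linSubst_Mtau : linSubst (MatIdx m) ℂ (Mtau m) = rename (swapIdx m) := by
  refine MvPolynomial.algHom_ext fun i => ?_
  rw [linSubst_X, sum_Mtau_smul, rename_X]

/-- `det (Xᵀ) = det X` for the generic matrix: renaming along `Prod.swap` fixes `detPoly`. -/
theorem rename_swap_detPoly (n : Type*) [Fintype n] [DecidableEq n] :
    rename Prod.swap (detPoly n ℂ) = detPoly n ℂ := by
  rw [detPoly, AlgHom.map_det]
  have : (rename (Prod.swap : n × n → n × n)).mapMatrix (Matrix.mvPolynomialX n n ℂ)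
      = (Matrix.mvPolynomialX n n ℂ)ᵀ := by
    ext i j : 1
    simp [Matrix.mvPolynomialX, rename_X]
  rw [this, Matrix.det_transpose]

/-- `M_τ` stabilises `det_m`: `linSubst M_τ det_m = det_m`. -/
theorem linSubst_Mtau_detFormLex : linSubst (MatIdx m) ℂ (Mtau m) (detFormLex ℂ m) = detFormLex ℂ m := by
  rw [linSubst_Mtau, detFormLex, rename_rename]
  have : (swapIdx m ∘ toLex : Fin m × Fin m → MatIdx m) = toLex ∘ Prod.swap := by
    funext ⟨a, b⟩; rfl
  rw [this, ← rename_rename, rename_swap_detPoly]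

/-- Column transposition of the coordinates of `End(ℂ^{m×m})`: `A ↦ A M_τ` transposes every row. -/
def colSwap (m : ℕ) (p : Idx m) : Idx m := (p.1, swapIdx m p.2)

/-- An `H`-invariant is invariant under transposing every row (`M_τ ∈ H`). -/
theorem rename_colSwap_of_mem_stabInv {G : MvPolynomial (Idx m) ℂ} (hG : G ∈ stabInv m) :
    rename (colSwap m) G = G := by
  have h := (Submodule.mem_iInf _).mp ((Submodule.mem_iInf _).mp hG (Mtau m)) linSubst_Mtau_detFormLex
  rw [LinearMap.mem_ker, LinearMap.sub_apply, sub_eq_zero] at h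
  have hre : (MvPolynomial.aeval (R := ℂ) fun p : Idx m =>
      ∑ l : MatIdx m, Mtau m l p.2 • MvPolynomial.X (p.1, l)) = rename (colSwap m) := by
    refine MvPolynomial.algHom_ext fun p => ?_
    rw [aeval_X, rename_X, colSwap]
    exact sum_Mtau_smul (fun l => (X (p.1, l) : MvPolynomial (Idx m) ℂ)) p.2
  rw [← hre]
  exact h

/-- On `L_Λ`, transposing every row is negation. -/
theorem comp_colSwap_of_mem_locus {p : Idx m → ℂ} (hp : p ∈ locus m (skewU m)) :
    p ∘ colSwap m = (-1 : ℂ) • p := by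
  funext q
  obtain ⟨j, i⟩ := q
  have h := skew_of_mem_skewU (hp j) (ofLex i).2 (ofLex i).1
  simp only [Function.comp_apply, colSwap, swapIdx, Pi.smul_apply, smul_eq_mul, neg_one_mul]
  simpa using h

/-- **Parity.** If the degree `D` is odd, every `H`-invariant form of degree `D` vanishes on `L_Λ`. -/
theorem eval_eq_zero_of_odd {D : ℕ} (hD : Odd D) {G : MvPolynomial (Idx m) ℂ}
    (hGh : G.IsHomogeneous D) (hGs : G ∈ stabInv m) {p : Idx m → ℂ} (hp : p ∈ locus m (skewU m)) :
    MvPolynomial.eval p G = 0 := by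
  have h1 : MvPolynomial.eval p G = MvPolynomial.eval (p ∘ colSwap m) G := by
    conv_lhs => rw [← rename_colSwap_of_mem_stabInv hGs]
    rw [eval_rename]
  rw [comp_colSwap_of_mem_locus hp, eval_smul_of_isHomogeneous hGh, hD.neg_one_pow] at h1
  linear_combination h1 / 2

/-- **No cut at threshold one in odd degree**: `T_Λ(1) = T_Λ(0)` whenever `D` is odd, for every
weight `χ` (the highest-weight condition is not used). -/
theorem truncSkew_one_eq_zero_of_odd {D : ℕ} (hD : Odd D) (χ : Weight (MatIdx m)) :
    truncU m D (skewU m) χ 1 = truncU m D (skewU m) χ 0 := by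
  refine le_antisymm (truncU_le_zero 1) fun G hG => ?_
  have hG' := hG
  rw [truncU_zero, Submodule.mem_inf, Submodule.mem_inf] at hG'
  obtain ⟨⟨hGh, hGs⟩, hGw⟩ := hG'
  unfold truncU
  refine Submodule.mem_inf.mpr ⟨Submodule.mem_inf.mpr ⟨Submodule.mem_inf.mpr ⟨hGh, ?_⟩, hGs⟩, hGw⟩
  rw [pow_one, Submodule.restrictScalars_mem, vanI, mem_vanishingIdeal_iff]
  intro p hp
  simpa [MvPolynomial.coe_aeval_eq_eval] using eval_eq_zero_of_odd hD hGh hGs hp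

/-- In particular for odd `m` and odd `δ`: `T_Λ(1) = T_Λ(0)` at every `λ`. -/
theorem trunc_one_eq_trunc_zero_of_odd {δ : ℕ} (hm : Odd m) (hδ : Odd δ)
    (lam : Nat.Partition (m * δ)) : trunc m δ lam 1 = trunc m δ lam 0 :=
  truncSkew_one_eq_zero_of_odd (hm.mul hδ) _

/-- The natural strengthening "the cut already bites in degree `m`" (`δ = 1`, threshold `1`). -/
def CutBitesAtDeltaOne : Prop :=
  ∀ m : ℕ, Odd m → 3 ≤ m → ∃ lam : Nat.Partition (m * 1), lam.parts.card ≤ m * m ∧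
    Module.finrank ℂ ↥(trunc m 1 lam 1) < Module.finrank ℂ ↥(trunc m 1 lam 0)

/-- **Refuted strengthening.** `δ = 1` never witnesses the crux: for odd `m` (already `m = 3`)
`T_Λ(1) = T_Λ(0)` in degree `m` for every weight. The first possible rung is `δ = 2`. -/
theorem not_cutBitesAtDeltaOne : ¬ CutBitesAtDeltaOne := by
  intro h
  obtain ⟨lam, -, hlt⟩ := h 3 (by decide) le_rfl
  rw [trunc_one_eq_trunc_zero_of_odd (by decide) odd_one] at hlt
  exact lt_irrefl _ hlt

/-- More generally no odd `m` and odd `δ` admit a witness at threshold `1`, a fortiori none at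
threshold `t` with `T(t) = T(0)` … only thresholds `≥ 2` can be compared with `T(1) = T(0)`. -/
theorem finrank_trunc_one_eq_of_odd {δ : ℕ} (hm : Odd m) (hδ : Odd δ) (lam : Nat.Partition (m * δ)) :
    Module.finrank ℂ ↥(trunc m δ lam 1) = Module.finrank ℂ ↥(trunc m δ lam 0) := by
  rw [trunc_one_eq_trunc_zero_of_odd hm hδ]

end Parity

/-! ## §D Non-vacuity and MEMBERSHIP TEMPLATES: the det-of-the-last-row invariant

`detRow m j = det_m(row j of A)`.  For the LAST row `j = jTop` (bottom-right index in the lex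
order) and the one-row partition `λ = (mδ)`, `detRow ^ δ` lies in `T(0)` — this certifies in Lean
that the crux's weight / dual / Borel / `g⁻¹` conventions fit together (`T(0) ≠ ⊥`), and the three
membership proofs (`detRow_mem_stabInv`, `detRow_pow_mem_hwSp`, homogeneity) are the templates a
prover needs for any explicit witness.  For odd `m` the same element lies in `T(δ)` as well
(`det` vanishes on odd skew matrices, to order ≥ 1, so `det^δ ∈ P_Λ^δ`): the obvious invariant NEVER
witnesses the cut, consistent with §C and with the FFT heuristics (`T_0((mδ)) = ℂ·detRow^δ`, not
proved here). -/

section DetRow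

variable {m : ℕ}

/-- Unfolding `stabInv` membership. -/
theorem mem_stabInv_iff {G : MvPolynomial (Idx m) ℂ} :
    G ∈ stabInv m ↔ ∀ M : Matrix (MatIdx m) (MatIdx m) ℂ,
      linSubst (MatIdx m) ℂ M (detFormLex ℂ m) = detFormLex ℂ m →
      MvPolynomial.aeval (R := ℂ) (fun p : Idx m =>
        ∑ l : MatIdx m, M l p.2 • MvPolynomial.X (p.1, l)) G = G := by
  simp only [stabInv, Submodule.mem_iInf, LinearMap.mem_ker, LinearMap.sub_apply, sub_eq_zero,
    AlgHom.toLinearMap_apply, LinearMap.id_coe, id_eq]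

/-- Unfolding `hwSp` membership. -/
theorem mem_hwSp_iff {χ : Weight (MatIdx m)} {G : MvPolynomial (Idx m) ℂ} :
    G ∈ hwSp m χ ↔ ∀ g : Matrix.GeneralLinearGroup (MatIdx m) ℂ, IsUpperTriangular g →
      MvPolynomial.aeval (R := ℂ) (fun p : Idx m =>
        ∑ l : MatIdx m, ((g⁻¹ : Matrix.GeneralLinearGroup (MatIdx m) ℂ) :
          Matrix (MatIdx m) (MatIdx m) ℂ) p.1 l • MvPolynomial.X (l, p.2)) G = weightChar χ g • G := by
  simp only [hwSp, Submodule.mem_iInf, LinearMap.mem_ker, LinearMap.sub_apply, sub_eq_zero,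
    AlgHom.toLinearMap_apply, LinearMap.smul_apply, LinearMap.id_coe, id_eq]

/-- `A ↦ det_m(row j of A)`: the determinant form in the coordinates of row `j`. -/
def detRow (m : ℕ) (j : MatIdx m) : MvPolynomial (Idx m) ℂ :=
  rename (fun i : MatIdx m => (j, i)) (detFormLex ℂ m)

theorem detRow_isHomogeneous (j : MatIdx m) : (detRow m j).IsHomogeneous m :=
  (detFormLex_isHomogeneous ℂ m).rename_isHomogeneous

theorem detFormLex_ne_zero (m : ℕ) : detFormLex ℂ m ≠ 0 := fun h =>
  Matrix.det_mvPolynomialX_ne_zero (m := Fin m) (R := ℂ)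
    (rename_injective _ toLex.injective (h.trans (map_zero _).symm))

theorem detRow_ne_zero (j : MatIdx m) : detRow m j ≠ 0 := fun h =>
  detFormLex_ne_zero m (rename_injective _ (Prod.mk_right_injective j) (h.trans (map_zero _).symm))

/-- TEMPLATE (stabiliser factor): the row action `A ↦ A M` intertwines `rename (j, ·)` with
`linSubst M` — so every form built from `det_m` of rows is `H`-invariant by the HYPOTHESIS on `M`
alone (no Frobenius needed for pull-back-type functions). -/
theorem aeval_rowAct_rename (M : Matrix (MatIdx m) (MatIdx m) ℂ) (j : MatIdx m)
    (q : MvPolynomial (MatIdx m) ℂ) :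
    MvPolynomial.aeval (R := ℂ) (fun p : Idx m =>
        ∑ l : MatIdx m, M l p.2 • MvPolynomial.X (p.1, l)) (rename (fun i : MatIdx m => (j, i)) q)
      = rename (fun i : MatIdx m => (j, i)) (linSubst (MatIdx m) ℂ M q) := by
  rw [aeval_rename]
  have : (rename (fun i : MatIdx m => (j, i))).comp (linSubst (MatIdx m) ℂ M)
      = MvPolynomial.aeval (R := ℂ) ((fun p : Idx m =>
          ∑ l : MatIdx m, M l p.2 • MvPolynomial.X (p.1, l)) ∘ fun i : MatIdx m => (j, i)) := by
    refine MvPolynomial.algHom_ext fun i => ?_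
    simp [linSubst_X, map_sum, rename_X]
  exact (AlgHom.congr_fun this q).symm

/-- `detRow` is `H`-invariant. -/
theorem detRow_mem_stabInv (j : MatIdx m) : detRow m j ∈ stabInv m := by
  rw [mem_stabInv_iff]
  intro M hM
  rw [detRow, aeval_rowAct_rename, hM]

/-- `stabInv` is closed under products (it is the subalgebra of `H`-invariants). -/
theorem mul_mem_stabInv {G G' : MvPolynomial (Idx m) ℂ} (hG : G ∈ stabInv m)
    (hG' : G' ∈ stabInv m) : G * G' ∈ stabInv m := by
  rw [mem_stabInv_iff] at hG hG' ⊢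
  intro M hM
  rw [map_mul, hG M hM, hG' M hM]

theorem pow_mem_stabInv {G : MvPolynomial (Idx m) ℂ} (hG : G ∈ stabInv m) (δ : ℕ) :
    G ^ δ ∈ stabInv m := by
  rw [mem_stabInv_iff] at hG ⊢
  intro M hM
  rw [map_pow, hG M hM]

/-- Rescaling the variables of a homogeneous form (bookkeeping for the Borel factor). -/
theorem aeval_smul_X_of_isHomogeneous {σ τ : Type*} {φ : MvPolynomial σ ℂ} {k : ℕ}
    (hφ : φ.IsHomogeneous k) (c : ℂ) (f : σ → τ) :
    MvPolynomial.aeval (R := ℂ) (fun i => c • (X (f i) : MvPolynomial τ ℂ)) φ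
      = C (c ^ k) * rename f φ := by
  have hre : (rename f : MvPolynomial σ ℂ →ₐ[ℂ] MvPolynomial τ ℂ)
      = MvPolynomial.aeval (R := ℂ) (fun i => (X (f i) : MvPolynomial τ ℂ)) :=
    MvPolynomial.algHom_ext fun i => by rw [rename_X, aeval_X]
  rw [show rename f φ = _ from AlgHom.congr_fun hre φ]
  conv_lhs => rw [φ.as_sum]
  conv_rhs => rw [φ.as_sum]
  rw [map_sum, map_sum, Finset.mul_sum]
  refine Finset.sum_congr rfl fun d hd => ?_
  have hdeg : (∑ i ∈ d.support, d i) = k := by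
    have := hφ (mem_support_iff.mp hd)
    simpa [Finsupp.weight_apply, Finsupp.sum] using this
  simp only [aeval_monomial, MvPolynomial.algebraMap_eq, smul_eq_C_mul, mul_pow, Finsupp.prod,
    Finset.prod_mul_distrib, ← map_pow, ← map_prod, Finset.prod_pow_eq_pow_sum, hdeg]
  ring

variable {n : ℕ}

/-- The last matrix index `(m-1, m-1)` of `MatIdx m`, `m = n + 1`, in the lexicographic order. -/
def jTop (n : ℕ) : MatIdx (n + 1) := matIdxEquiv (n + 1) (Fin.rev 0)

theorem le_jTop (l : MatIdx (n + 1)) : l ≤ jTop n := by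
  rw [jTop, ← (matIdxEquiv (n + 1)).apply_symm_apply l, (matIdxEquiv (n + 1)).le_iff_le,
    Fin.le_iff_val_le_val, Fin.val_rev]
  have := ((matIdxEquiv (n + 1)).symm l).isLt
  simp only [Fin.val_zero, zero_add]
  exact Nat.le_sub_one_of_lt this

theorem lt_jTop_of_ne {l : MatIdx (n + 1)} (hl : l ≠ jTop n) : l < jTop n :=
  lt_of_le_of_ne (le_jTop l) hl

theorem isUpperTriangular_inv {k : ℕ} {g : Matrix.GeneralLinearGroup (MatIdx k) ℂ}
    (hg : IsUpperTriangular g) : IsUpperTriangular g⁻¹ :=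
  (mem_borelSubgroup_iff _).mp ((borelSubgroup _ ℂ).inv_mem ((mem_borelSubgroup_iff _).mpr hg))

theorem inv_jTop_apply_eq_zero {g : Matrix.GeneralLinearGroup (MatIdx (n + 1)) ℂ}
    (hg : IsUpperTriangular g) {l : MatIdx (n + 1)} (hl : l ≠ jTop n) :
    ((g⁻¹ : Matrix.GeneralLinearGroup (MatIdx (n + 1)) ℂ) : Matrix _ _ ℂ) (jTop n) l = 0 :=
  (isUpperTriangular_inv hg).apply_eq_zero (lt_jTop_of_ne hl)

theorem inv_jTop_mul_jTop {g : Matrix.GeneralLinearGroup (MatIdx (n + 1)) ℂ}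
    (hg : IsUpperTriangular g) :
    ((g⁻¹ : Matrix.GeneralLinearGroup (MatIdx (n + 1)) ℂ) : Matrix _ _ ℂ) (jTop n) (jTop n)
      * (g : Matrix _ _ ℂ) (jTop n) (jTop n) = 1 := by
  have h := diag_mul_of_isUpperTriangular (isUpperTriangular_inv hg) hg (jTop n)
  rw [inv_mul_cancel, Units.val_one, Matrix.one_apply_eq] at h
  exact h.symm

/-- For upper-triangular `g`, the Borel action on the LAST row is a rescaling. -/
theorem sum_borelAct_jTop {g : Matrix.GeneralLinearGroup (MatIdx (n + 1)) ℂ}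
    (hg : IsUpperTriangular g) (i : MatIdx (n + 1)) :
    ∑ l : MatIdx (n + 1), ((g⁻¹ : Matrix.GeneralLinearGroup (MatIdx (n + 1)) ℂ) :
        Matrix _ _ ℂ) (jTop n) l • (X (l, i) : MvPolynomial (Idx (n + 1)) ℂ)
      = ((g⁻¹ : Matrix.GeneralLinearGroup (MatIdx (n + 1)) ℂ) : Matrix _ _ ℂ) (jTop n) (jTop n)
          • (X (jTop n, i) : MvPolynomial (Idx (n + 1)) ℂ) := by
  refine Finset.sum_eq_single (jTop n) (fun l _ hl => ?_) (fun h => absurd (Finset.mem_univ _) h)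
  rw [inv_jTop_apply_eq_zero hg hl, zero_smul]

/-- TEMPLATE (Borel factor): the Borel action on `detRow` of the last row. -/
theorem aeval_borelAct_detRow_jTop {g : Matrix.GeneralLinearGroup (MatIdx (n + 1)) ℂ}
    (hg : IsUpperTriangular g) :
    MvPolynomial.aeval (R := ℂ) (fun p : Idx (n + 1) =>
        ∑ l : MatIdx (n + 1), ((g⁻¹ : Matrix.GeneralLinearGroup (MatIdx (n + 1)) ℂ) :
          Matrix _ _ ℂ) p.1 l • MvPolynomial.X (l, p.2)) (detRow (n + 1) (jTop n))
      = C ((((g⁻¹ : Matrix.GeneralLinearGroup (MatIdx (n + 1)) ℂ) : Matrix _ _ ℂ)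
            (jTop n) (jTop n)) ^ (n + 1)) * detRow (n + 1) (jTop n) := by
  rw [detRow, aeval_rename]
  have : ((fun p : Idx (n + 1) =>
        ∑ l : MatIdx (n + 1), ((g⁻¹ : Matrix.GeneralLinearGroup (MatIdx (n + 1)) ℂ) :
          Matrix _ _ ℂ) p.1 l • (MvPolynomial.X (l, p.2) : MvPolynomial (Idx (n + 1)) ℂ))
          ∘ fun i : MatIdx (n + 1) => (jTop n, i))
      = fun i => (((g⁻¹ : Matrix.GeneralLinearGroup (MatIdx (n + 1)) ℂ) : Matrix _ _ ℂ)
            (jTop n) (jTop n)) • (X ((fun i : MatIdx (n + 1) => (jTop n, i)) i) :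
              MvPolynomial (Idx (n + 1)) ℂ) := by
    funext i
    exact sum_borelAct_jTop hg i
  rw [this, aeval_smul_X_of_isHomogeneous (detFormLex_isHomogeneous ℂ (n + 1))]

/-- The one-row partition `(D)`. -/
def rowPartition (D : ℕ) : Nat.Partition D := Nat.Partition.indiscrete D

/-- The weight `((mδ))*` of the crux at the one-row partition, `m = n + 1`. -/
def chiRow (n δ : ℕ) : Weight (MatIdx (n + 1)) :=
  (Weight.dualOfPartition ((n + 1) * (n + 1)) (rowPartition ((n + 1) * δ))).toMatIdx

theorem sortedParts_indiscrete {D : ℕ} (hD : D ≠ 0) :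
    (Nat.Partition.indiscrete D).sortedParts = [D] := by
  rw [Nat.Partition.sortedParts, Nat.Partition.indiscrete_parts hD, Multiset.sort_singleton]

/-- The weight `((mδ))*` is `-mδ` at the last index and `0` elsewhere (route conventions, in Lean). -/
theorem chiRow_apply {δ : ℕ} (hδ : 0 < δ) (ij : MatIdx (n + 1)) :
    chiRow n δ ij = if ij = jTop n then -(((n + 1) * δ : ℕ) : ℤ) else 0 := by
  have hD : (n + 1) * δ ≠ 0 := by positivity
  simp only [chiRow, rowPartition, Weight.toMatIdx, Weight.dualOfPartition, Weight.dual,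
    Weight.ofPartition, sortedParts_indiscrete hD]
  by_cases h : ij = jTop n
  · subst h
    rw [if_pos rfl, jTop, OrderIso.symm_apply_apply, Fin.rev_rev]
    simp
  · rw [if_neg h]
    have hne : Fin.rev ((matIdxEquiv (n + 1)).symm ij) ≠ 0 := by
      intro h0
      apply h
      rw [Fin.rev_eq_iff] at h0
      rw [jTop, ← h0, OrderIso.apply_symm_apply]
    have hv : ((Fin.rev ((matIdxEquiv (n + 1)).symm ij) : Fin ((n + 1) * (n + 1))) : ℕ) ≠ 0 := by
      intro h0
      exact hne (Fin.ext (by rw [h0, Fin.val_zero]))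
    obtain ⟨k, hk⟩ := Nat.exists_eq_succ_of_ne_zero hv
    rw [hk, List.getD_cons_succ, List.getD_nil]
    simp

/-- The weight character of `((mδ))*` on the Borel: `g ↦ (g_last,last)^(-mδ)`. -/
theorem weightChar_chiRow {δ : ℕ} (hδ : 0 < δ) (g : Matrix.GeneralLinearGroup (MatIdx (n + 1)) ℂ) :
    weightChar (chiRow n δ) g
      = ((g : Matrix _ _ ℂ) (jTop n) (jTop n)) ^ (-(((n + 1) * δ : ℕ) : ℤ)) := by
  rw [weightChar, Finset.prod_eq_single (jTop n)]
  · rw [chiRow_apply hδ, if_pos rfl]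
  · intro i _ hi
    rw [chiRow_apply hδ, if_neg hi, zpow_zero]
  · intro h
    exact absurd (Finset.mem_univ _) h

/-- `detRow(last)^δ` is a `B`-semi-invariant of weight `((mδ))*` (conventions certified). -/
theorem detRow_pow_mem_hwSp {δ : ℕ} (hδ : 0 < δ) :
    detRow (n + 1) (jTop n) ^ δ ∈ hwSp (n + 1) (chiRow n δ) := by
  rw [mem_hwSp_iff]
  intro g hg
  rw [map_pow, aeval_borelAct_detRow_jTop hg, mul_pow, ← map_pow, ← pow_mul, weightChar_chiRow hδ,
    smul_eq_C_mul, zpow_neg, zpow_natCast]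
  congr 2
  rw [← inv_pow, ← eq_inv_of_mul_eq_one_left (inv_jTop_mul_jTop hg)]

/-- **Non-vacuity / conventions certificate.** `detRow(last)^δ ∈ T(0)` at `λ = (mδ)`, `δ ≥ 1`. -/
theorem detRow_pow_mem_trunc_zero {δ : ℕ} (hδ : 0 < δ) :
    detRow (n + 1) (jTop n) ^ δ ∈ trunc (n + 1) δ (rowPartition ((n + 1) * δ)) 0 := by
  rw [trunc, truncU_zero]
  refine Submodule.mem_inf.mpr ⟨Submodule.mem_inf.mpr ⟨?_, ?_⟩, ?_⟩
  · exact (detRow_isHomogeneous _).pow δ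
  · exact pow_mem_stabInv (detRow_mem_stabInv _) δ
  · exact detRow_pow_mem_hwSp hδ

/-- `T(0) ≠ ⊥` at the one-row weight, for every `m ≥ 1` and `δ ≥ 1`. -/
theorem trunc_zero_ne_bot {δ : ℕ} (hδ : 0 < δ) :
    trunc (n + 1) δ (rowPartition ((n + 1) * δ)) 0 ≠ ⊥ := fun h =>
  pow_ne_zero δ (detRow_ne_zero _) ((Submodule.eq_bot_iff _).mp h _ (detRow_pow_mem_trunc_zero hδ))

/-- For odd `m`, `detRow` vanishes on `L_Λ` (an odd skew matrix is singular). -/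
theorem detRow_mem_vanI_of_odd (hm : Odd (n + 1)) (j : MatIdx (n + 1)) :
    detRow (n + 1) j ∈ vanI (n + 1) (skewU (n + 1)) := by
  rw [vanI, mem_vanishingIdeal_iff]
  intro p hp
  rw [detRow, aeval_rename, detFormLex, aeval_rename]
  have hdet : MvPolynomial.aeval (R := ℂ) ((p ∘ fun i : MatIdx (n + 1) => (j, i)) ∘ toLex)
      (detPoly (Fin (n + 1)) ℂ) = (Matrix.of fun a b : Fin (n + 1) => p (j, toLex (a, b))).det := by
    rw [detPoly, AlgHom.map_det]
    congr 1
    ext a b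
    simp [Matrix.mvPolynomialX]
  rw [hdet]
  set S : Matrix (Fin (n + 1)) (Fin (n + 1)) ℂ := Matrix.of fun a b => p (j, toLex (a, b)) with hSdef
  have hS : Sᵀ = -S := by
    ext a b
    simp only [Matrix.transpose_apply, Matrix.neg_apply, hSdef, Matrix.of_apply]
    exact skew_of_mem_skewU (hp j) b a
  have h1 : S.det = (-1) ^ (n + 1) * S.det := by
    conv_lhs => rw [← Matrix.det_transpose, hS, Matrix.det_neg]
    rw [Fintype.card_fin]
  rw [hm.neg_one_pow] at h1
  linear_combination h1 / 2

/-- For odd `m` the same element also lies in `T(δ)`: **the obvious invariant never witnesses the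
cut** (both `T(0)` and `T(δ)` are non-zero at `λ = (mδ)`). -/
theorem detRow_pow_mem_trunc_delta_of_odd (hm : Odd (n + 1)) {δ : ℕ} (hδ : 0 < δ) :
    detRow (n + 1) (jTop n) ^ δ ∈ trunc (n + 1) δ (rowPartition ((n + 1) * δ)) δ := by
  have h0 := detRow_pow_mem_trunc_zero (n := n) hδ
  rw [trunc, truncU_zero, Submodule.mem_inf, Submodule.mem_inf] at h0
  obtain ⟨⟨hH, hS⟩, hW⟩ := h0
  unfold trunc truncU
  refine Submodule.mem_inf.mpr ⟨Submodule.mem_inf.mpr ⟨Submodule.mem_inf.mpr ⟨hH, ?_⟩, hS⟩, hW⟩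
  rw [Submodule.restrictScalars_mem]
  exact Ideal.pow_mem_pow (detRow_mem_vanI_of_odd hm _) δ

theorem trunc_delta_ne_bot_of_odd (hm : Odd (n + 1)) {δ : ℕ} (hδ : 0 < δ) :
    trunc (n + 1) δ (rowPartition ((n + 1) * δ)) δ ≠ ⊥ := fun h =>
  pow_ne_zero δ (detRow_ne_zero _)
    ((Submodule.eq_bot_iff _).mp h _ (detRow_pow_mem_trunc_delta_of_odd hm hδ))

end DetRow

/-! ## §E `Odd m` is not load-bearing for truth: the conclusion holds at the even `m = 4`

For even `m` the generic skew matrix is invertible, so `det_m(last row)` (an element of `T(0)` at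
`λ = (m)`, `δ = 1`, by §D) does not vanish on `L_Λ`: by §B the cut bites trivially.  We certify the
instance `m = 4` (point: every row equal to the standard symplectic `J₄`, `J₄ J₄ᵀ = 1`).  So the
hypothesis `Odd m` carries MEANING (threshold `δ(m - r)` with `r = m - 1`), not truth; any "proof must
use oddness" claim is false for the conclusion as typed. -/

section EvenFour

/-- `aeval` of `detRow` at a point is the determinant of that row, reshaped to `m × m`. -/
theorem aeval_detRow {m : ℕ} (p : Idx m → ℂ) (j : MatIdx m) :
    MvPolynomial.aeval (R := ℂ) p (detRow m j)
      = (Matrix.of fun a b : Fin m => p (j, toLex (a, b))).det := by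
  rw [detRow, aeval_rename, detFormLex, aeval_rename, detPoly, AlgHom.map_det]
  congr 1
  ext a b
  simp [Matrix.mvPolynomialX]

/-- The standard symplectic `4 × 4` matrix `J₄ = J ⊕ J`, `J = [[0,1],[-1,0]]`. -/
def J4 : Matrix (Fin 4) (Fin 4) ℂ := !![0, 1, 0, 0; -1, 0, 0, 0; 0, 0, 0, 1; 0, 0, -1, 0]

theorem J4_mul_transpose : J4 * J4ᵀ = 1 := by
  ext i j
  fin_cases i <;> fin_cases j <;> simp [J4, Matrix.mul_apply, Fin.sum_univ_four]

theorem J4_det_ne_zero : J4.det ≠ 0 := by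
  intro h
  have h1 := congrArg Matrix.det J4_mul_transpose
  rw [Matrix.det_mul, Matrix.det_transpose, h, Matrix.det_one, zero_mul] at h1
  exact zero_ne_one h1

theorem J4_skew (a b : Fin 4) : J4 a b = -J4 b a := by
  fin_cases a <;> fin_cases b <;> simp [J4]

/-- The point of `End(ℂ^{4×4})` all of whose rows equal `J₄`. -/
def pJ : Idx (3 + 1) → ℂ := fun q => J4 (ofLex q.2).1 (ofLex q.2).2

theorem pJ_mem_locus : pJ ∈ locus (3 + 1) (skewU (3 + 1)) := by
  intro j
  refine Submodule.subset_span fun a b => ?_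
  simp only [pJ]
  exact J4_skew a b

theorem eval_pJ_detRow_ne_zero (j : MatIdx (3 + 1)) :
    MvPolynomial.eval pJ (detRow (3 + 1) j) ≠ 0 := by
  have h : MvPolynomial.eval pJ (detRow (3 + 1) j)
      = (Matrix.of fun a b : Fin (3 + 1) => pJ (j, toLex (a, b))).det := aeval_detRow pJ j
  rw [h]
  have hJ : (Matrix.of fun a b : Fin (3 + 1) => pJ (j, toLex (a, b))) = J4 := by
    ext a b
    simp [pJ]
  rw [hJ]
  exact J4_det_ne_zero

/-- **`Odd m` is not load-bearing for truth.**  At the even `m = 4` the crux's conclusion holds: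
`δ = 1`, `λ = (4)`, witness `det₄(last row) ∈ T(0) \ T(1)`. -/
theorem cutBites_conclusion_at_four :
    ∃ (δ : ℕ) (lam : Nat.Partition ((3 + 1) * δ)), lam.parts.card ≤ (3 + 1) * (3 + 1) ∧
      Module.finrank ℂ ↥(trunc (3 + 1) δ lam δ) < Module.finrank ℂ ↥(trunc (3 + 1) δ lam 0) := by
  refine ⟨1, rowPartition ((3 + 1) * 1), ?_, ?_⟩
  · simp [rowPartition, Nat.Partition.indiscrete_parts]
  · have hmem := detRow_pow_mem_trunc_zero (n := 3) (δ := 1) one_pos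
    rw [pow_one] at hmem
    exact finrank_lt_of_eval_ne_zero one_pos hmem pJ_mem_locus (eval_pJ_detRow_ne_zero _)

end EvenFour

/-! ## §F No Edmonds gap ⇒ no cut: the column compression space never cuts at the route threshold

`U_col = {X ∈ Mat_m : column 0 of X = 0}` is a singular space of (generic) rank `r = m - 1` WITHOUT
Edmonds gap (`rk = ncrk = m - 1`).  The torus element `M_q = (X ↦ X · diag(q))`, `q₀ = (1/2)^{m-1}`, `q_b = 2` (`b ≠ 0`),
lies in the `End`-stabiliser of `det_m` (`∏ q = 1`), and invariance under it forces every
monomial of an `H`-invariant form of degree `mδ` to have degree EXACTLY `δ` in the column-0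
variables; hence `G ∈ P_{U_col}^δ` and `T_{U_col}(t) = T_{U_col}(0)` for all `t ≤ δ = δ(m - r)`:
the truncation at the route's threshold is vacuous.  Consequently the strengthening of the crux /
of `ValuativeFlip`'s mechanism "EVERY non-zero singular space of rank `≤ r < m` cuts at threshold
`δ(m-r)` for some `(δ, λ)`" is FALSE (`not_cutBitesEveryRankBoundedSpace`, witness `m = 3`, `U_col`,
`r = 2`).  Dichotomy behind it (paper): the cut at threshold `δ(m - rk U)` bites iff `ncrk U > rk U`. -/

section ColumnCompression

variable {n : ℕ}

/-- The compression space `U_col = {X : column 0 of X vanishes}` in `Mat_{n+1}`. -/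
def colU (n : ℕ) : Submodule ℂ (MatIdx (n + 1) → ℂ) :=
  Submodule.span ℂ {u : MatIdx (n + 1) → ℂ | ∀ a : Fin (n + 1), u (toLex (a, 0)) = 0}

theorem apply_col_zero_of_mem_colU {u : MatIdx (n + 1) → ℂ} (hu : u ∈ colU n) (a : Fin (n + 1)) :
    u (toLex (a, 0)) = 0 := by
  induction hu using Submodule.span_induction generalizing a with
  | mem x hx => exact hx a
  | zero => simp
  | add x y _ _ hx hy => rw [Pi.add_apply, hx, hy, add_zero]
  | smul c x _ hx => rw [Pi.smul_apply, hx, smul_zero]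

/-- Every element of `U_col` has rank `≤ m - 1 = n` (it factors through the last `n` columns). -/
theorem rank_le_of_mem_colU {u : MatIdx (n + 1) → ℂ} (hu : u ∈ colU n) :
    (Matrix.of fun a b : Fin (n + 1) => u (toLex (a, b))).rank ≤ n := by
  set X : Matrix (Fin (n + 1)) (Fin (n + 1)) ℂ := Matrix.of fun a b => u (toLex (a, b)) with hXdef
  have hX : X = X.submatrix id Fin.succ
      * Matrix.of (fun (i : Fin n) (b : Fin (n + 1)) => if b = i.succ then (1 : ℂ) else 0) := by
    ext a b
    rw [Matrix.mul_apply]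
    by_cases hb : b = 0
    · subst hb
      simp [hXdef, apply_col_zero_of_mem_colU hu a, (Fin.succ_ne_zero _).symm]
    · obtain ⟨i, rfl⟩ := Fin.exists_succ_eq.mpr hb
      simp [Fin.succ_inj]
  rw [hX]
  exact (Matrix.rank_mul_le_left _ _).trans (Matrix.rank_le_width _)

/-- Column weights of the torus element: `q 0 = (1/2)^n`, `q b = 2` otherwise. -/
def qcol (n : ℕ) (b : Fin (n + 1)) : ℂ := if b = 0 then (2⁻¹ : ℂ) ^ n else 2

theorem prod_qcol : ∏ b : Fin (n + 1), qcol n b = 1 := by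
  rw [Fin.prod_univ_succ]
  simp only [qcol, if_true, Fin.succ_ne_zero, if_false, Finset.prod_const, Finset.card_univ,
    Fintype.card_fin]
  rw [← mul_pow, inv_mul_cancel₀ (two_ne_zero' ℂ), one_pow]

/-- The torus element `M_q = diag(q_{col i})`, i.e. `X ↦ X · diag(q)`, of `End(ℂ^{m×m})`. -/
def Mq (n : ℕ) : Matrix (MatIdx (n + 1)) (MatIdx (n + 1)) ℂ :=
  Matrix.diagonal fun i => qcol n (ofLex i).2

theorem linSubst_Mq :
    linSubst (MatIdx (n + 1)) ℂ (Mq n)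
      = MvPolynomial.aeval (R := ℂ) fun i : MatIdx (n + 1) =>
          qcol n (ofLex i).2 • (X i : MvPolynomial (MatIdx (n + 1)) ℂ) := by
  refine MvPolynomial.algHom_ext fun i => ?_
  rw [linSubst_X, aeval_X]
  simp [Mq, Matrix.diagonal_apply, ite_smul, Finset.sum_ite_eq']

/-- **`M_q ∈ Stab_End(det_m)`**: rescaling column `b` by `q_b` with `∏ q = 1` fixes `det_m`. -/
theorem linSubst_Mq_detFormLex :
    linSubst (MatIdx (n + 1)) ℂ (Mq n) (detFormLex ℂ (n + 1)) = detFormLex ℂ (n + 1) := by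
  rw [linSubst_Mq, detFormLex, aeval_rename]
  have h1 : MvPolynomial.aeval (R := ℂ) ((fun i : MatIdx (n + 1) =>
        qcol n (ofLex i).2 • (X i : MvPolynomial (MatIdx (n + 1)) ℂ)) ∘ toLex) (detPoly (Fin (n + 1)) ℂ)
      = Matrix.det (Matrix.of fun i j : Fin (n + 1) => (fun b : Fin (n + 1) => C (qcol n b)) j
          * (Matrix.of fun a b : Fin (n + 1) =>
              (X (toLex (a, b)) : MvPolynomial (MatIdx (n + 1)) ℂ)) i j) := by
    rw [detPoly, AlgHom.map_det]
    congr 1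
    ext a b
    simp [Matrix.mvPolynomialX, smul_eq_C_mul]
  have h2 : rename toLex (detPoly (Fin (n + 1)) ℂ)
      = Matrix.det (Matrix.of fun a b : Fin (n + 1) =>
          (X (toLex (a, b)) : MvPolynomial (MatIdx (n + 1)) ℂ)) := by
    rw [detPoly, AlgHom.map_det]
    congr 1
    ext a b
    simp [Matrix.mvPolynomialX, rename_X]
  rw [h1, Matrix.det_mul_row, ← map_prod, prod_qcol, map_one, one_mul, h2]

/-- The row action of `M_q` on `End(ℂ^{m×m})` rescales the coordinate `A(j, (a,b))` by `q_b`. -/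
theorem rowAct_Mq_eq :
    (MvPolynomial.aeval (R := ℂ) fun p : Idx (n + 1) =>
        ∑ l : MatIdx (n + 1), Mq n l p.2 • MvPolynomial.X (p.1, l))
      = MvPolynomial.aeval (R := ℂ) fun p : Idx (n + 1) =>
          qcol n (ofLex p.2).2 • (X p : MvPolynomial (Idx (n + 1)) ℂ) := by
  refine MvPolynomial.algHom_ext fun p => ?_
  rw [aeval_X, aeval_X]
  simp [Mq, Matrix.diagonal_apply, ite_smul, Finset.sum_ite_eq']

/-- Coefficients under a diagonal rescaling of the variables. -/
theorem coeff_aeval_smul_X {σ : Type*} (c : σ → ℂ) (G : MvPolynomial σ ℂ) (α : σ →₀ ℕ) :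
    coeff α (MvPolynomial.aeval (R := ℂ) (fun p => c p • (X p : MvPolynomial σ ℂ)) G)
      = (∏ p ∈ α.support, c p ^ α p) * coeff α G := by
  classical
  have hmon : ∀ β : σ →₀ ℕ, MvPolynomial.aeval (R := ℂ) (fun p => c p • (X p : MvPolynomial σ ℂ))
      (monomial β (coeff β G)) = C (∏ p ∈ β.support, c p ^ β p) * monomial β (coeff β G) := by
    intro β
    rw [aeval_monomial, MvPolynomial.algebraMap_eq, monomial_eq]
    simp only [Finsupp.prod, smul_eq_C_mul, mul_pow, Finset.prod_mul_distrib, ← map_pow, ← map_prod]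
    ring
  conv_lhs => rw [G.as_sum]
  rw [map_sum, coeff_sum]
  simp only [hmon, coeff_C_mul, coeff_monomial]
  rw [Finset.sum_eq_single α]
  · rw [if_pos rfl]
  · intro β _ hβ
    rw [if_neg hβ, mul_zero]
  · intro hα
    rw [if_pos rfl, notMem_support_iff.mp hα, mul_zero]

/-- Invariance under a diagonal rescaling forces weight `1` on every monomial. -/
theorem prod_eq_one_of_invariant {σ : Type*} {c : σ → ℂ} {G : MvPolynomial σ ℂ}
    (hG : MvPolynomial.aeval (R := ℂ) (fun p => c p • (X p : MvPolynomial σ ℂ)) G = G)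
    {α : σ →₀ ℕ} (hα : α ∈ G.support) : ∏ p ∈ α.support, c p ^ α p = 1 := by
  have h := congrArg (coeff α) hG
  rw [coeff_aeval_smul_X] at h
  exact (mul_eq_right₀ (mem_support_iff.mp hα)).mp h

/-- The `M_q`-weight of a monomial in terms of its column-0 degree. -/
theorem prod_qcol_pow (α : Idx (n + 1) →₀ ℕ) :
    ∏ p ∈ α.support, qcol n (ofLex p.2).2 ^ α p
      = (2⁻¹ : ℂ) ^ (n * ∑ p ∈ α.support with (ofLex p.2).2 = 0, α p)
        * 2 ^ (∑ p ∈ α.support with ¬(ofLex p.2).2 = 0, α p) := by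
  rw [← Finset.prod_filter_mul_prod_filter_not α.support (fun p => (ofLex p.2).2 = 0)]
  congr 1
  · rw [pow_mul, ← Finset.prod_pow_eq_pow_sum]
    refine Finset.prod_congr rfl fun p hp => ?_
    rw [qcol, if_pos (Finset.mem_filter.mp hp).2]
  · rw [← Finset.prod_pow_eq_pow_sum]
    refine Finset.prod_congr rfl fun p hp => ?_
    rw [qcol, if_neg (Finset.mem_filter.mp hp).2]

/-- Column-0 coordinates vanish on `L_{U_col}`. -/
theorem X_mem_vanI_colU {p : Idx (n + 1)} (hp : (ofLex p.2).2 = 0) :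
    (X p : MvPolynomial (Idx (n + 1)) ℂ) ∈ vanI (n + 1) (colU n) := by
  rw [vanI, mem_vanishingIdeal_iff]
  intro x hx
  rw [aeval_X]
  have hrow := apply_col_zero_of_mem_colU (hx p.1) (ofLex p.2).1
  have hp' : toLex ((ofLex p.2).1, (0 : Fin (n + 1))) = p.2 := by
    rw [← hp]
    rfl
  rw [hp'] at hrow
  exact hrow

/-- **Multi-magic / no cut for the compression space.**  For every `m = n + 1 ≥ 1`, `δ`, weight `χ`
and threshold `t ≤ δ`: `T_{U_col}(t) = T_{U_col}(0)` in degree `mδ`. -/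
theorem truncU_colU_eq (δ t : ℕ) (ht : t ≤ δ) (χ : Weight (MatIdx (n + 1))) :
    truncU (n + 1) ((n + 1) * δ) (colU n) χ t = truncU (n + 1) ((n + 1) * δ) (colU n) χ 0 := by
  refine le_antisymm (truncU_le_zero t) fun G hG => ?_
  have hG' := hG
  rw [truncU_zero, Submodule.mem_inf, Submodule.mem_inf] at hG'
  obtain ⟨⟨hGh, hGs⟩, hGw⟩ := hG'
  unfold truncU
  refine Submodule.mem_inf.mpr ⟨Submodule.mem_inf.mpr ⟨Submodule.mem_inf.mpr ⟨hGh, ?_⟩, hGs⟩, hGw⟩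
  rw [Submodule.restrictScalars_mem]
  have hinv : MvPolynomial.aeval (R := ℂ) (fun p : Idx (n + 1) =>
      qcol n (ofLex p.2).2 • (X p : MvPolynomial (Idx (n + 1)) ℂ)) G = G := by
    rw [← rowAct_Mq_eq]
    exact (mem_stabInv_iff.mp hGs) (Mq n) linSubst_Mq_detFormLex
  rw [G.as_sum]
  refine Ideal.sum_mem _ fun α hα => ?_
  have hw := prod_eq_one_of_invariant hinv hα
  rw [prod_qcol_pow] at hw
  have hdeg : (∑ p ∈ α.support, α p) = (n + 1) * δ := by
    have := hGh (mem_support_iff.mp hα)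
    simpa [Finsupp.weight_apply, Finsupp.sum] using this
  set e0 := ∑ p ∈ α.support with (ofLex p.2).2 = 0, α p with he0
  set e1 := ∑ p ∈ α.support with ¬(ofLex p.2).2 = 0, α p with he1
  have hsum : e0 + e1 = (n + 1) * δ := by
    rw [he0, he1, Finset.sum_filter_add_sum_filter_not]
    exact hdeg
  have h2 : (2 : ℂ) ^ e1 = 2 ^ (n * e0) := by
    have h3 : (2 : ℂ) ^ (n * e0) * ((2⁻¹ : ℂ) ^ (n * e0) * 2 ^ e1) = 2 ^ (n * e0) := by
      rw [hw, mul_one]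
    rwa [← mul_assoc, ← mul_pow, mul_inv_cancel₀ (two_ne_zero' ℂ), one_pow, one_mul] at h3
  have h3 : e1 = n * e0 := Nat.pow_right_injective le_rfl (by exact_mod_cast h2)
  have h4 : e0 = δ := by
    apply Nat.eq_of_mul_eq_mul_left (Nat.succ_pos n)
    calc (n + 1) * e0 = e0 + n * e0 := by ring
      _ = e0 + e1 := by rw [h3]
      _ = (n + 1) * δ := hsum
  rw [monomial_eq, Finsupp.prod,
    ← Finset.prod_filter_mul_prod_filter_not α.support (fun p => (ofLex p.2).2 = 0)]
  refine Ideal.mul_mem_left _ _ (Ideal.mul_mem_right _ _ ?_)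
  have hte : t ≤ e0 := h4 ▸ ht
  refine Ideal.pow_le_pow_right hte ?_
  rw [he0, ← Finset.prod_pow_eq_pow_sum]
  exact Ideal.prod_mem_prod fun p hp => Ideal.pow_mem_pow (X_mem_vanI_colU (Finset.mem_filter.mp hp).2) _

/-- The strengthening "EVERY non-zero singular space `U` of rank `≤ r < m` cuts at the route's
threshold `δ(m - r)`" (the shape of `ValuativeFlip`'s `∃ U r δ λ`, made universal in `U`). -/
def CutBitesEveryRankBoundedSpace : Prop :=
  ∀ m : ℕ, 3 ≤ m → ∀ (U : Submodule ℂ (MatIdx m → ℂ)) (r : ℕ),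
    (∀ u ∈ U, (Matrix.of fun a b : Fin m => u (toLex (a, b))).rank ≤ r) → r < m → U ≠ ⊥ →
    ∃ (δ : ℕ) (lam : Nat.Partition (m * δ)), lam.parts.card ≤ m * m ∧
      Module.finrank ℂ ↥(truncU m (m * δ) U (Weight.dualOfPartition (m * m) lam).toMatIdx (δ * (m - r)))
        < Module.finrank ℂ ↥(truncU m (m * δ) U (Weight.dualOfPartition (m * m) lam).toMatIdx 0)

theorem colU_two_ne_bot : colU 2 ≠ ⊥ := by
  intro h
  have hmem : (fun i : MatIdx (2 + 1) => if i = toLex ((0 : Fin (2 + 1)), (1 : Fin (2 + 1))) then (1 : ℂ) else 0)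
      ∈ colU 2 := by
    refine Submodule.subset_span fun a => ?_
    simp
  rw [h, Submodule.mem_bot] at hmem
  have := congr_fun hmem (toLex ((0 : Fin (2 + 1)), (1 : Fin (2 + 1))))
  simp at this

/-- **Refuted strengthening.**  Not every singular space cuts: the compression space `U_col ⊂ Mat₃`
(rank `≤ 2 < 3`, non-zero) has `T(δ·(3-2)) = T(0)` for every `(δ, λ)` (`truncU_colU_eq`). -/
theorem not_cutBitesEveryRankBoundedSpace : ¬ CutBitesEveryRankBoundedSpace := by
  intro h
  have hU : ∀ u ∈ colU 2, (Matrix.of fun a b : Fin (2 + 1) => u (toLex (a, b))).rank ≤ 2 :=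
    fun u hu => rank_le_of_mem_colU hu
  obtain ⟨δ, lam, -, hlt⟩ := h (2 + 1) le_rfl (colU 2) 2 hU (Nat.lt_succ_self 2) colU_two_ne_bot
  have hthr : δ * (2 + 1 - 2) = δ := by norm_num
  rw [hthr, truncU_colU_eq δ δ le_rfl] at hlt
  exact lt_irrefl _ hlt

end ColumnCompression

/-! ## §G Parity of the normal order: `T_Λ(1) = T_Λ(2)` in EVEN degree, for every `m`

Split every row into its skew and symmetric parts, `A = S + N`.  The transposition matrix `M_τ ∈ H`
(§C) gives, for an `H`-invariant form `G` of degree `D`, `G(S + N) = G(-S + N) = (-1)^D G(S - N)`: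
`G` is EVEN in the normal (symmetric) directions when `D` is even and ODD when `D` is odd, so the
order of vanishing of `G` along `L_Λ = {N = 0}` has the parity of `D`.  §C is the case "order `≥ 0`
⇒ `≥ 1`" (`D` odd); here is the case "order `≥ 1` ⇒ `≥ 2`" (`D` even), which needs no description of
`P_Λ^t` beyond the trivial inclusion `(n-coordinates)^2 ⊆ P_Λ²`: in skew/symmetric coordinates
(`kappa` / `theta`) an `H`-invariant `G ∈ P_Λ` of even degree has only monomials of `n`-degree
`≥ 1` (restriction to `n = 0` vanishes, `MvPolynomial.funext`) and even (`M_τ`), hence `≥ 2`.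

Consequences.  `truncSkew_two_eq_one_of_even`: `T_Λ(2) = T_Λ(1)` for every `m`, every even `D`,
every weight.  At the crux's FIRST RUNG `δ = 2` (`D = 2m` is even for every `m`):
`trunc m 2 λ 2 = trunc m 2 λ 1` (`trunc_firstRung_two_eq_one`), so
* the natural strengthening "the filtration also drops at the second step, `finrank T(2) <
  finrank T(1)`" is FALSE (`not_cutBitesStrictSecondStep`, witness `m = 3`, in fact every `m`);
* `finrank T(2) < finrank T(0)` holds IFF some element of `T(0)` has a non-zero value on `L_Λ`
  (`firstRung_lt_iff_witness`): at `δ = 2` the witness shape of §B / `cutBites_of_witness` is not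
  only sufficient but NECESSARY — the threshold `t = δ = 2` of the crux is immaterial there, the
  first rung is exactly "an `H`-invariant highest-weight form of degree `2m` not vanishing on the
  skew tuples" (what all three registered lines prove). -/

section NormalParity

variable {m : ℕ}

theorem colSwap_colSwap (p : Idx m) : colSwap m (colSwap m p) = p := rfl

/-- OLD coordinates in terms of the NEW skew/symmetric ones (row by row): with `s = X (j,(a,b))`
kept at the upper index `a < b`, `n = X (j,(b,a))` kept at the lower index and `n = X (j,(a,a))` on
the diagonal, `A_ab = (s + n)/2`, `A_ba = (n - s)/2`, `A_aa = n`. -/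
def kappa (m : ℕ) (p : Idx m) : MvPolynomial (Idx m) ℂ :=
  if (ofLex p.2).1 < (ofLex p.2).2 then C (2⁻¹ : ℂ) * (X p + X (colSwap m p))
  else if (ofLex p.2).2 < (ofLex p.2).1 then C (2⁻¹ : ℂ) * (X p - X (colSwap m p))
  else X p

/-- NEW coordinates in terms of the OLD ones: `s_ab = A_ab - A_ba` (upper index),
`n_ba = A_ba + A_ab` (lower index), `n_aa = A_aa` (diagonal). -/
def theta (m : ℕ) (p : Idx m) : MvPolynomial (Idx m) ℂ :=
  if (ofLex p.2).1 < (ofLex p.2).2 then X p - X (colSwap m p)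
  else if (ofLex p.2).2 < (ofLex p.2).1 then X p + X (colSwap m p)
  else X p

/-- The normal reflection `N ↦ -N` in the new coordinates: `+1` on `s`, `-1` on `n`. -/
def nuSign (m : ℕ) (p : Idx m) : ℂ := if (ofLex p.2).1 < (ofLex p.2).2 then 1 else -1

/-- The restriction to `L_Λ = {n = 0}` in the new coordinates: `1` on `s`, `0` on `n`. -/
def zetaSign (m : ℕ) (p : Idx m) : ℂ := if (ofLex p.2).1 < (ofLex p.2).2 then 1 else 0

/-- Restriction to `n = 0` read in the OLD coordinates: the generic skew tuple built from the
upper-triangular variables. -/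
def piMap (m : ℕ) (p : Idx m) : MvPolynomial (Idx m) ℂ :=
  if (ofLex p.2).1 < (ofLex p.2).2 then C (2⁻¹ : ℂ) * X p
  else if (ofLex p.2).2 < (ofLex p.2).1 then -(C (2⁻¹ : ℂ) * X (colSwap m p))
  else 0

section Cases

variable {p : Idx m}

theorem kappa_of_lt (h : (ofLex p.2).1 < (ofLex p.2).2) :
    kappa m p = C (2⁻¹ : ℂ) * (X p + X (colSwap m p)) := if_pos h
theorem kappa_of_gt (h : (ofLex p.2).2 < (ofLex p.2).1) :
    kappa m p = C (2⁻¹ : ℂ) * (X p - X (colSwap m p)) := by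
  rw [kappa, if_neg (not_lt_of_gt h), if_pos h]
theorem kappa_of_eq (h : (ofLex p.2).1 = (ofLex p.2).2) : kappa m p = X p := by
  rw [kappa, if_neg (by rw [h]; exact lt_irrefl _), if_neg (by rw [h]; exact lt_irrefl _)]
theorem theta_of_lt (h : (ofLex p.2).1 < (ofLex p.2).2) :
    theta m p = X p - X (colSwap m p) := if_pos h
theorem theta_of_gt (h : (ofLex p.2).2 < (ofLex p.2).1) :
    theta m p = X p + X (colSwap m p) := by
  rw [theta, if_neg (not_lt_of_gt h), if_pos h]
theorem theta_of_eq (h : (ofLex p.2).1 = (ofLex p.2).2) : theta m p = X p := by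
  rw [theta, if_neg (by rw [h]; exact lt_irrefl _), if_neg (by rw [h]; exact lt_irrefl _)]
theorem piMap_of_lt (h : (ofLex p.2).1 < (ofLex p.2).2) :
    piMap m p = C (2⁻¹ : ℂ) * X p := if_pos h
theorem piMap_of_gt (h : (ofLex p.2).2 < (ofLex p.2).1) :
    piMap m p = -(C (2⁻¹ : ℂ) * X (colSwap m p)) := by
  rw [piMap, if_neg (not_lt_of_gt h), if_pos h]
theorem piMap_of_eq (h : (ofLex p.2).1 = (ofLex p.2).2) : piMap m p = 0 := by
  rw [piMap, if_neg (by rw [h]; exact lt_irrefl _), if_neg (by rw [h]; exact lt_irrefl _)]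
theorem nuSign_of_lt (h : (ofLex p.2).1 < (ofLex p.2).2) : nuSign m p = 1 := if_pos h
theorem nuSign_of_not_lt (h : ¬ (ofLex p.2).1 < (ofLex p.2).2) : nuSign m p = -1 := if_neg h
theorem zetaSign_of_lt (h : (ofLex p.2).1 < (ofLex p.2).2) : zetaSign m p = 1 := if_pos h
theorem zetaSign_of_not_lt (h : ¬ (ofLex p.2).1 < (ofLex p.2).2) : zetaSign m p = 0 := if_neg h

/-- The partner index has the two comparisons exchanged. -/
theorem colSwap_gt_of_lt (h : (ofLex p.2).1 < (ofLex p.2).2) :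
    (ofLex (colSwap m p).2).2 < (ofLex (colSwap m p).2).1 := h
theorem colSwap_lt_of_gt (h : (ofLex p.2).2 < (ofLex p.2).1) :
    (ofLex (colSwap m p).2).1 < (ofLex (colSwap m p).2).2 := h
theorem colSwap_eq_self_of_eq (h : (ofLex p.2).1 = (ofLex p.2).2) : colSwap m p = p := by
  obtain ⟨j, i⟩ := p
  simp only [colSwap, swapIdx, Prod.mk.injEq, true_and]
  change (ofLex i).1 = (ofLex i).2 at h
  rw [← h]
  exact congrArg toLex (Prod.ext rfl h)

end Cases

theorem C_half_mul_two : C (2⁻¹ : ℂ) * 2 = (1 : MvPolynomial (Idx m) ℂ) := by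
  rw [← map_ofNat C 2, ← map_mul, inv_mul_cancel₀ two_ne_zero, map_one]

/-- `θ ∘ κ = id` on variables. -/
theorem aeval_theta_kappa (p : Idx m) :
    MvPolynomial.aeval (R := ℂ) (theta m) (kappa m p) = X p := by
  have h2 := C_half_mul_two (m := m)
  rcases lt_trichotomy (ofLex p.2).1 (ofLex p.2).2 with h | h | h
  · rw [kappa_of_lt h, map_mul, aeval_C, algebraMap_eq, map_add, aeval_X, aeval_X, theta_of_lt h,
      theta_of_gt (colSwap_gt_of_lt h), colSwap_colSwap]
    linear_combination (X p) * h2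
  · rw [kappa_of_eq h, aeval_X, theta_of_eq h]
  · rw [kappa_of_gt h, map_mul, aeval_C, algebraMap_eq, map_sub, aeval_X, aeval_X, theta_of_gt h,
      theta_of_lt (colSwap_lt_of_gt h), colSwap_colSwap]
    linear_combination (X p) * h2

theorem aeval_theta_comp_kappa :
    (MvPolynomial.aeval (R := ℂ) (theta m)).comp (MvPolynomial.aeval (R := ℂ) (kappa m))
      = AlgHom.id ℂ (MvPolynomial (Idx m) ℂ) :=
  MvPolynomial.algHom_ext fun p => by rw [AlgHom.comp_apply, aeval_X, aeval_theta_kappa, AlgHom.id_apply]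

/-- Every polynomial is recovered from its skew/symmetric rewriting. -/
theorem aeval_theta_aeval_kappa (G : MvPolynomial (Idx m) ℂ) :
    MvPolynomial.aeval (R := ℂ) (theta m) (MvPolynomial.aeval (R := ℂ) (kappa m) G) = G := by
  have := AlgHom.congr_fun (aeval_theta_comp_kappa (m := m)) G
  simpa using this

/-- The normal reflection in new coordinates is "negate and transpose every row" in old ones. -/
theorem aeval_nu_kappa (p : Idx m) :
    MvPolynomial.aeval (R := ℂ) (fun q => nuSign m q • (X q : MvPolynomial (Idx m) ℂ)) (kappa m p)
      = MvPolynomial.aeval (R := ℂ) (kappa m)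
          ((-1 : ℂ) • (X (colSwap m p) : MvPolynomial (Idx m) ℂ)) := by
  rcases lt_trichotomy (ofLex p.2).1 (ofLex p.2).2 with h | h | h
  · rw [kappa_of_lt h]
    simp only [map_mul, map_add, aeval_C, algebraMap_eq, aeval_X, smul_eq_C_mul]
    rw [nuSign_of_lt h, nuSign_of_not_lt (not_lt_of_gt (colSwap_gt_of_lt h)),
      kappa_of_gt (colSwap_gt_of_lt h), colSwap_colSwap]
    simp only [map_one, map_neg]
    ring
  · rw [kappa_of_eq h]
    simp only [aeval_X, smul_eq_C_mul, map_mul, aeval_C, algebraMap_eq]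
    rw [nuSign_of_not_lt (by rw [h]; exact lt_irrefl _), colSwap_eq_self_of_eq h, kappa_of_eq h]
  · rw [kappa_of_gt h]
    simp only [map_mul, map_sub, aeval_C, algebraMap_eq, aeval_X, smul_eq_C_mul]
    rw [nuSign_of_not_lt (not_lt_of_gt h), nuSign_of_lt (colSwap_lt_of_gt h),
      kappa_of_lt (colSwap_lt_of_gt h), colSwap_colSwap]
    simp only [map_one, map_neg]
    ring

theorem aeval_nu_comp_kappa :
    (MvPolynomial.aeval (R := ℂ) (fun q => nuSign m q • (X q : MvPolynomial (Idx m) ℂ))).comp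
        (MvPolynomial.aeval (R := ℂ) (kappa m))
      = (MvPolynomial.aeval (R := ℂ) (kappa m)).comp
          (MvPolynomial.aeval (R := ℂ) fun p => (-1 : ℂ) • (X (colSwap m p) : MvPolynomial (Idx m) ℂ)) :=
  MvPolynomial.algHom_ext fun p => by rw [AlgHom.comp_apply, AlgHom.comp_apply, aeval_X, aeval_X, aeval_nu_kappa]

/-- The restriction to `n = 0` in new coordinates is the generic-skew substitution in old ones. -/
theorem aeval_zeta_kappa (p : Idx m) :
    MvPolynomial.aeval (R := ℂ) (fun q => zetaSign m q • (X q : MvPolynomial (Idx m) ℂ)) (kappa m p)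
      = piMap m p := by
  rcases lt_trichotomy (ofLex p.2).1 (ofLex p.2).2 with h | h | h
  · rw [kappa_of_lt h, map_mul, aeval_C, algebraMap_eq, map_add, aeval_X, aeval_X, zetaSign_of_lt h,
      zetaSign_of_not_lt (not_lt_of_gt (colSwap_gt_of_lt h)), piMap_of_lt h]
    simp only [one_smul, zero_smul, add_zero]
  · rw [kappa_of_eq h, aeval_X, zetaSign_of_not_lt (by rw [h]; exact lt_irrefl _), piMap_of_eq h,
      zero_smul]
  · rw [kappa_of_gt h, map_mul, aeval_C, algebraMap_eq, map_sub, aeval_X, aeval_X,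
      zetaSign_of_not_lt (not_lt_of_gt h), zetaSign_of_lt (colSwap_lt_of_gt h), piMap_of_gt h]
    simp only [one_smul, zero_smul, zero_sub, mul_neg]

theorem aeval_zeta_comp_kappa :
    (MvPolynomial.aeval (R := ℂ) (fun q => zetaSign m q • (X q : MvPolynomial (Idx m) ℂ))).comp
        (MvPolynomial.aeval (R := ℂ) (kappa m))
      = MvPolynomial.aeval (R := ℂ) (piMap m) :=
  MvPolynomial.algHom_ext fun p => by rw [AlgHom.comp_apply, aeval_X, aeval_X, aeval_zeta_kappa]

/-- Every value of the generic-skew substitution is a point of `L_Λ`. -/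
theorem piPoint_mem_locus (x : Idx m → ℂ) :
    (fun p => MvPolynomial.eval x (piMap m p)) ∈ locus m (skewU m) := by
  intro j
  refine Submodule.subset_span fun a b => ?_
  rcases lt_trichotomy a b with h | h | h
  · have h1 : (ofLex (j, toLex (a, b)).2).1 < (ofLex (j, toLex (a, b)).2).2 := h
    have h2 : (ofLex (j, toLex (b, a)).2).2 < (ofLex (j, toLex (b, a)).2).1 := h
    simp only [piMap_of_lt h1, piMap_of_gt h2, map_neg, map_mul, eval_C, eval_X, neg_neg]
    rfl
  · subst h
    have h1 : (ofLex (j, toLex (a, a)).2).1 = (ofLex (j, toLex (a, a)).2).2 := rfl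
    simp only [piMap_of_eq h1, map_zero, neg_zero]
  · have h1 : (ofLex (j, toLex (a, b)).2).2 < (ofLex (j, toLex (a, b)).2).1 := h
    have h2 : (ofLex (j, toLex (b, a)).2).1 < (ofLex (j, toLex (b, a)).2).2 := h
    simp only [piMap_of_gt h1, piMap_of_lt h2, map_neg, map_mul, eval_C, eval_X]
    rfl

/-- A form vanishing on `L_Λ` dies under the generic-skew substitution. -/
theorem aeval_piMap_eq_zero_of_mem_vanI {G : MvPolynomial (Idx m) ℂ} (hG : G ∈ vanI m (skewU m)) :
    MvPolynomial.aeval (R := ℂ) (piMap m) G = 0 := by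
  refine MvPolynomial.funext fun x => ?_
  rw [map_zero]
  have hcomp := AlgHom.congr_fun (MvPolynomial.comp_aeval (piMap m) (MvPolynomial.aeval (R := ℂ) x)) G
  rw [AlgHom.comp_apply] at hcomp
  rw [vanI, mem_vanishingIdeal_iff] at hG
  have h0 := hG _ (piPoint_mem_locus x)
  have key : MvPolynomial.aeval (R := ℂ) x (MvPolynomial.aeval (R := ℂ) (piMap m) G) = 0 :=
    hcomp.trans h0
  simpa [MvPolynomial.coe_aeval_eq_eval] using key

/-- `n`-degree of an exponent vector: its total degree in the normal coordinates. -/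
def nDeg (α : Idx m →₀ ℕ) : ℕ := ∑ p ∈ α.support with ¬ (ofLex p.2).1 < (ofLex p.2).2, α p

theorem prod_nuSign_pow (α : Idx m →₀ ℕ) :
    ∏ p ∈ α.support, nuSign m p ^ α p = (-1) ^ nDeg α := by
  rw [← Finset.prod_filter_mul_prod_filter_not α.support (fun p => (ofLex p.2).1 < (ofLex p.2).2),
    Finset.prod_eq_one (fun p hp => by rw [nuSign_of_lt (Finset.mem_filter.mp hp).2, one_pow]),
    one_mul, nDeg, ← Finset.prod_pow_eq_pow_sum]
  exact Finset.prod_congr rfl fun p hp => by rw [nuSign_of_not_lt (Finset.mem_filter.mp hp).2]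

theorem prod_zetaSign_pow (α : Idx m →₀ ℕ) :
    ∏ p ∈ α.support, zetaSign m p ^ α p = if nDeg α = 0 then 1 else 0 := by
  rw [← Finset.prod_filter_mul_prod_filter_not α.support (fun p => (ofLex p.2).1 < (ofLex p.2).2),
    Finset.prod_eq_one (fun p hp => by rw [zetaSign_of_lt (Finset.mem_filter.mp hp).2, one_pow]),
    one_mul]
  by_cases h0 : nDeg α = 0
  · rw [if_pos h0]
    refine Finset.prod_eq_one fun p hp => ?_
    exfalso
    have hmem := Finset.mem_filter.mp hp
    have hpos : 0 < α p := Nat.pos_of_ne_zero (Finsupp.mem_support_iff.mp hmem.1)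
    have hle : α p ≤ nDeg α :=
      Finset.single_le_sum (f := fun p => α p) (fun _ _ => Nat.zero_le _) hp
    omega
  · rw [if_neg h0]
    obtain ⟨p, hp, hαp⟩ := Finset.exists_ne_zero_of_sum_ne_zero h0
    exact Finset.prod_eq_zero hp (by rw [zetaSign_of_not_lt (Finset.mem_filter.mp hp).2, zero_pow hαp])

/-- The new `n`-coordinates, read in old coordinates, vanish on `L_Λ`. -/
theorem theta_mem_vanI {p : Idx m} (hp : ¬ (ofLex p.2).1 < (ofLex p.2).2) :
    theta m p ∈ vanI m (skewU m) := by
  rw [vanI, mem_vanishingIdeal_iff]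
  intro x hx
  obtain ⟨j, i⟩ := p
  have hsk := skew_of_mem_skewU (hx j) (ofLex i).1 (ofLex i).2
  have hi : toLex ((ofLex i).1, (ofLex i).2) = i := rfl
  rw [hi] at hsk
  rcases (not_lt.mp hp).lt_or_eq with h | h
  · have h' : (ofLex (j, i).2).2 < (ofLex (j, i).2).1 := h
    rw [theta_of_gt h', map_add, aeval_X, aeval_X]
    change x (j, i) + x (j, toLex ((ofLex i).2, (ofLex i).1)) = 0
    rw [hsk]
    ring
  · have h' : (ofLex (j, i).2).1 = (ofLex (j, i).2).2 := h.symm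
    rw [theta_of_eq h', aeval_X]
    change x (j, i) = 0
    have hii : toLex ((ofLex i).2, (ofLex i).1) = i := congrArg Prod.snd (colSwap_eq_self_of_eq h')
    rw [hii] at hsk
    linear_combination hsk / 2

/-- **Parity of the normal order (even degree).**  An `H`-invariant form of even degree that
vanishes on `L_Λ` vanishes there to order `≥ 2`: `G ∈ P_Λ ⇒ G ∈ P_Λ²`. -/
theorem mem_vanI_sq_of_even {D : ℕ} (hD : Even D) {G : MvPolynomial (Idx m) ℂ}
    (hGh : G.IsHomogeneous D) (hGs : G ∈ stabInv m) (hGv : G ∈ vanI m (skewU m)) :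
    G ∈ (vanI m (skewU m)) ^ 2 := by
  set G' := MvPolynomial.aeval (R := ℂ) (kappa m) G with hG'
  -- (a) `G'` is even in the normal coordinates
  have ha : MvPolynomial.aeval (R := ℂ) (fun q => nuSign m q • (X q : MvPolynomial (Idx m) ℂ)) G'
      = G' := by
    have h := AlgHom.congr_fun (aeval_nu_comp_kappa (m := m)) G
    rw [AlgHom.comp_apply, AlgHom.comp_apply] at h
    rw [hG', h, aeval_smul_X_of_isHomogeneous hGh (-1) (colSwap m), hD.neg_one_pow, map_one, one_mul,
      rename_colSwap_of_mem_stabInv hGs]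
  -- (b) `G'` restricted to `n = 0` vanishes
  have hb : MvPolynomial.aeval (R := ℂ) (fun q => zetaSign m q • (X q : MvPolynomial (Idx m) ℂ)) G'
      = 0 := by
    have h := AlgHom.congr_fun (aeval_zeta_comp_kappa (m := m)) G
    rw [AlgHom.comp_apply] at h
    rw [hG', h]
    exact aeval_piMap_eq_zero_of_mem_vanI hGv
  -- (c) every monomial of `G'` has `n`-degree `≥ 2`
  have hc : ∀ α ∈ G'.support, 2 ≤ nDeg α := by
    intro α hα
    have hne : coeff α G' ≠ 0 := mem_support_iff.mp hα
    have h1 := congrArg (coeff α) ha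
    rw [coeff_aeval_smul_X, prod_nuSign_pow] at h1
    have h2 := congrArg (coeff α) hb
    rw [coeff_aeval_smul_X, prod_zetaSign_pow, coeff_zero] at h2
    have hn0 : nDeg α ≠ 0 := by
      intro h0
      rw [if_pos h0, one_mul] at h2
      exact hne h2
    have hev : Even (nDeg α) := by
      by_contra hodd
      rw [Nat.not_even_iff_odd] at hodd
      rw [hodd.neg_one_pow, neg_one_mul] at h1
      exact hne (by linear_combination -(h1 / 2))
    obtain ⟨k, hk⟩ := hev
    omega
  -- (d) back to old coordinates: the `n`-part of every monomial lies in `P_Λ²`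
  rw [← aeval_theta_aeval_kappa G, ← hG', G'.as_sum, map_sum]
  refine Ideal.sum_mem _ fun α hα => ?_
  rw [aeval_monomial, Finsupp.prod,
    ← Finset.prod_filter_mul_prod_filter_not α.support (fun p => (ofLex p.2).1 < (ofLex p.2).2)]
  refine Ideal.mul_mem_left _ _ (Ideal.mul_mem_left _ _ ?_)
  refine Ideal.pow_le_pow_right (hc α hα) ?_
  rw [nDeg, ← Finset.prod_pow_eq_pow_sum]
  exact Ideal.prod_mem_prod fun p hp => Ideal.pow_mem_pow (theta_mem_vanI (Finset.mem_filter.mp hp).2) _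

/-- **`T_Λ(2) = T_Λ(1)` in even degree**, for every `m` and every weight (companion of §C's
`truncSkew_one_eq_zero_of_odd`: together, the `L_Λ`-order of an `H`-invariant form of degree `D`
has the parity of `D`, as far as orders `≤ 2` are concerned). -/
theorem truncSkew_two_eq_one_of_even {D : ℕ} (hD : Even D) (χ : Weight (MatIdx m)) :
    truncU m D (skewU m) χ 2 = truncU m D (skewU m) χ 1 := by
  refine le_antisymm (truncU_anti one_le_two) fun G hG => ?_
  unfold truncU at hG ⊢
  rw [Submodule.mem_inf, Submodule.mem_inf, Submodule.mem_inf] at hG ⊢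
  obtain ⟨⟨⟨hGh, hGv⟩, hGs⟩, hGw⟩ := hG
  refine ⟨⟨⟨hGh, ?_⟩, hGs⟩, hGw⟩
  rw [Submodule.restrictScalars_mem, pow_one] at hGv
  rw [Submodule.restrictScalars_mem]
  exact mem_vanI_sq_of_even hD ((mem_homogeneousSubmodule _ _).mp hGh) hGs hGv

/-- For the crux's truncation: `T(2) = T(1)` whenever `mδ` is even. -/
theorem trunc_two_eq_one_of_even {δ : ℕ} (h : Even (m * δ)) (lam : Nat.Partition (m * δ)) :
    trunc m δ lam 2 = trunc m δ lam 1 :=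
  truncSkew_two_eq_one_of_even h _

/-- **First rung.**  At `δ = 2` (degree `2m`, even for EVERY `m`): `T(2) = T(1)` for every weight. -/
theorem trunc_firstRung_two_eq_one (m : ℕ) (lam : Nat.Partition (m * 2)) :
    trunc m 2 lam 2 = trunc m 2 lam 1 :=
  trunc_two_eq_one_of_even (Nat.even_mul.mpr (Or.inr even_two)) lam

/-- The natural strengthening "at the first rung the filtration also drops at the SECOND step". -/
def CutBitesStrictSecondStep : Prop :=
  ∀ m : ℕ, Odd m → 3 ≤ m → ∃ lam : Nat.Partition (m * 2), lam.parts.card ≤ m * m ∧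
    Module.finrank ℂ ↥(trunc m 2 lam 2) < Module.finrank ℂ ↥(trunc m 2 lam 1)

/-- **Refuted strengthening.**  `T(2) < T(1)` never happens at `δ = 2` (witness `m = 3`; by
`trunc_firstRung_two_eq_one` it fails at every `m` and every `λ`). -/
theorem not_cutBitesStrictSecondStep : ¬ CutBitesStrictSecondStep := by
  intro h
  obtain ⟨lam, -, hlt⟩ := h 3 (by decide) le_rfl
  rw [trunc_firstRung_two_eq_one] at hlt
  exact lt_irrefl _ hlt

/-- **The witness shape is necessary at the first rung.**  For every `m` and every `λ ⊢ 2m`: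
`finrank T(2) < finrank T(0)` iff some element of `T(0)` has a non-zero value on `L_Λ`
(⇐ is §B; ⇒ because `T(2) = T(1)` and `T(1)` is `T(0) ∩ P_Λ`). -/
theorem firstRung_lt_iff_witness (m : ℕ) (lam : Nat.Partition (m * 2)) :
    Module.finrank ℂ ↥(trunc m 2 lam 2) < Module.finrank ℂ ↥(trunc m 2 lam 0) ↔
      ∃ G ∈ trunc m 2 lam 0, ∃ p ∈ locus m (skewU m), MvPolynomial.eval p G ≠ 0 := by
  haveI : Module.Finite ℂ ↥(trunc m 2 lam 2) := by unfold trunc; infer_instance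
  constructor
  · intro hlt
    by_contra hno
    simp only [not_exists, not_and, not_not, ne_eq] at hno
    have hle : trunc m 2 lam 0 ≤ trunc m 2 lam 2 := by
      intro G hG
      rw [trunc_firstRung_two_eq_one]
      have hG0 := hG
      rw [trunc, truncU_zero, Submodule.mem_inf, Submodule.mem_inf] at hG0
      obtain ⟨⟨hGh, hGs⟩, hGw⟩ := hG0
      change G ∈ truncU m (m * 2) (skewU m) _ 1
      unfold truncU
      refine Submodule.mem_inf.mpr ⟨Submodule.mem_inf.mpr ⟨Submodule.mem_inf.mpr ⟨hGh, ?_⟩, hGs⟩, hGw⟩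
      rw [pow_one, Submodule.restrictScalars_mem, vanI, mem_vanishingIdeal_iff]
      intro p hp
      simpa [MvPolynomial.coe_aeval_eq_eval] using hno G hG p hp
    exact absurd (Submodule.finrank_mono hle) (not_le.mpr hlt)
  · rintro ⟨G, hG, p, hp, hGp⟩
    exact finrank_lt_of_eval_ne_zero two_pos hG hp hGp

/-- Hence the crux AT ITS FIRST RUNG is literally the order-zero statement: for odd `m ≥ 3`,
`(∃ λ ⊢ 2m, ≤ m² parts, finrank T(2) < finrank T(0)) ↔ (∃ λ, ≤ m² parts, ∃ G ∈ T(0), G ≢ 0 on L_Λ)`. -/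
theorem cutBites_firstRung_iff (m : ℕ) :
    (∃ lam : Nat.Partition (m * 2), lam.parts.card ≤ m * m ∧
        Module.finrank ℂ ↥(trunc m 2 lam 2) < Module.finrank ℂ ↥(trunc m 2 lam 0)) ↔
      ∃ lam : Nat.Partition (m * 2), lam.parts.card ≤ m * m ∧
        ∃ G ∈ trunc m 2 lam 0, ∃ p ∈ locus m (skewU m), MvPolynomial.eval p G ≠ 0 := by
  simp only [firstRung_lt_iff_witness]

/-! ### §G.2 The full parity law: `T_Λ(t+1) = T_Λ(t)` whenever `t + D` is odd (every `m`, every `t`)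

The missing half of §G: `P_Λ^t` IS the set of forms all of whose skew/symmetric monomials have `n`-degree
`≥ t` (`κ`/`θ` are inverse automorphisms; `κ(P_Λ) ⊆ (n-variables)` by the restriction argument; powers
of the monomial ideal by induction), so the parity of the `n`-degrees (`≡ D`, from `M_τ`) upgrades
`G ∈ P_Λ^t` to `G ∈ P_Λ^{t+1}` whenever `t ≢ D (mod 2)`.  Hence the valuative filtration of `Λ_m` jumps
only at orders `≡ D (mod 2)`: §C is `t = 0`, §G.1 is `t = 1`; for the crux (`D = mδ`, `m` odd):
odd `δ` ⇒ `T(δ) = T(δ-1)`, …, `T(1) = T(0)`; even `δ` ⇒ `T(δ+1) = T(δ)`, …, `T(2) = T(1)`. -/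

/-- `κ ∘ θ = id` on variables (so `κ`, `θ` are inverse automorphisms, with `aeval_theta_kappa`). -/
theorem aeval_kappa_theta (p : Idx m) :
    MvPolynomial.aeval (R := ℂ) (kappa m) (theta m p) = X p := by
  have h2 := C_half_mul_two (m := m)
  rcases lt_trichotomy (ofLex p.2).1 (ofLex p.2).2 with h | h | h
  · rw [theta_of_lt h, map_sub, aeval_X, aeval_X, kappa_of_lt h, kappa_of_gt (colSwap_gt_of_lt h),
      colSwap_colSwap]
    linear_combination (X p) * h2
  · rw [theta_of_eq h, aeval_X, kappa_of_eq h]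
  · rw [theta_of_gt h, map_add, aeval_X, aeval_X, kappa_of_gt h, kappa_of_lt (colSwap_lt_of_gt h),
      colSwap_colSwap]
    linear_combination (X p) * h2

theorem aeval_kappa_aeval_theta (G : MvPolynomial (Idx m) ℂ) :
    MvPolynomial.aeval (R := ℂ) (kappa m) (MvPolynomial.aeval (R := ℂ) (theta m) G) = G := by
  have hc : (MvPolynomial.aeval (R := ℂ) (kappa m)).comp (MvPolynomial.aeval (R := ℂ) (theta m))
      = AlgHom.id ℂ (MvPolynomial (Idx m) ℂ) :=
    MvPolynomial.algHom_ext fun p => by rw [AlgHom.comp_apply, aeval_X, aeval_kappa_theta, AlgHom.id_apply]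
  simpa using AlgHom.congr_fun hc G

/-- The normal reflection on `κ G`: multiplication by `(-1)^D` for an `H`-invariant form of degree `D`. -/
theorem aeval_nu_aeval_kappa {D : ℕ} {G : MvPolynomial (Idx m) ℂ} (hGh : G.IsHomogeneous D)
    (hGs : G ∈ stabInv m) :
    MvPolynomial.aeval (R := ℂ) (fun q => nuSign m q • (X q : MvPolynomial (Idx m) ℂ))
        (MvPolynomial.aeval (R := ℂ) (kappa m) G)
      = C ((-1 : ℂ) ^ D) * MvPolynomial.aeval (R := ℂ) (kappa m) G := by
  have h := AlgHom.congr_fun (aeval_nu_comp_kappa (m := m)) G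
  rw [AlgHom.comp_apply, AlgHom.comp_apply] at h
  rw [h, aeval_smul_X_of_isHomogeneous hGh (-1) (colSwap m), rename_colSwap_of_mem_stabInv hGs, map_mul,
    aeval_C, algebraMap_eq]

/-- **Parity of the `n`-degrees.**  Every monomial of `κ G` has `n`-degree `≡ D (mod 2)`. -/
theorem even_nDeg_add_of_mem_support {D : ℕ} {G : MvPolynomial (Idx m) ℂ} (hGh : G.IsHomogeneous D)
    (hGs : G ∈ stabInv m) {α : Idx m →₀ ℕ}
    (hα : α ∈ (MvPolynomial.aeval (R := ℂ) (kappa m) G).support) : Even (nDeg α + D) := by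
  by_contra hodd
  rw [Nat.not_even_iff_odd] at hodd
  have hne : coeff α (MvPolynomial.aeval (R := ℂ) (kappa m) G) ≠ 0 := mem_support_iff.mp hα
  have h1 := congrArg (coeff α) (aeval_nu_aeval_kappa hGh hGs)
  rw [coeff_aeval_smul_X, prod_nuSign_pow, coeff_C_mul] at h1
  have h2 : ((-1 : ℂ) ^ nDeg α * (-1) ^ nDeg α) * coeff α (MvPolynomial.aeval (R := ℂ) (kappa m) G)
      = (-1 : ℂ) ^ (nDeg α + D) * coeff α (MvPolynomial.aeval (R := ℂ) (kappa m) G) := by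
    rw [mul_assoc, h1, ← mul_assoc, ← pow_add]
  rw [← pow_add, ← two_mul, pow_mul, neg_one_sq, one_pow, one_mul, hodd.neg_one_pow, neg_one_mul] at h2
  exact hne (by linear_combination h2 / 2)

/-- The restriction argument: every monomial of `κ G` has POSITIVE `n`-degree when `G` vanishes on `L_Λ`. -/
theorem nDeg_pos_of_mem_support {G : MvPolynomial (Idx m) ℂ} (hGv : G ∈ vanI m (skewU m))
    {α : Idx m →₀ ℕ} (hα : α ∈ (MvPolynomial.aeval (R := ℂ) (kappa m) G).support) : 0 < nDeg α := by
  have hne : coeff α (MvPolynomial.aeval (R := ℂ) (kappa m) G) ≠ 0 := mem_support_iff.mp hα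
  have hb : MvPolynomial.aeval (R := ℂ) (fun q => zetaSign m q • (X q : MvPolynomial (Idx m) ℂ))
      (MvPolynomial.aeval (R := ℂ) (kappa m) G) = 0 := by
    have h := AlgHom.congr_fun (aeval_zeta_comp_kappa (m := m)) G
    rw [AlgHom.comp_apply] at h
    rw [h]
    exact aeval_piMap_eq_zero_of_mem_vanI hGv
  have h2 := congrArg (coeff α) hb
  rw [coeff_aeval_smul_X, prod_zetaSign_pow, coeff_zero] at h2
  by_contra h0
  rw [not_lt, Nat.le_zero] at h0
  rw [if_pos h0, one_mul] at h2
  exact hne h2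

/-- The monomial ideal of the `n`-variables (new coordinates). -/
def spanN (m : ℕ) : Ideal (MvPolynomial (Idx m) ℂ) :=
  Ideal.span ((fun q => (X q : MvPolynomial (Idx m) ℂ)) '' {q : Idx m | ¬ (ofLex q.2).1 < (ofLex q.2).2})

/-- `κ (P_Λ) ⊆ (n-variables)`. -/
theorem aeval_kappa_mem_spanN {G : MvPolynomial (Idx m) ℂ} (hGv : G ∈ vanI m (skewU m)) :
    MvPolynomial.aeval (R := ℂ) (kappa m) G ∈ spanN m := by
  rw [spanN, mem_ideal_span_X_image]
  intro α hα
  have hpos := nDeg_pos_of_mem_support hGv hα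
  obtain ⟨q, hq, hαq⟩ := Finset.exists_ne_zero_of_sum_ne_zero hpos.ne'
  exact ⟨q, (Finset.mem_filter.mp hq).2, hαq⟩

theorem map_kappa_vanI_le : Ideal.map (MvPolynomial.aeval (R := ℂ) (kappa m)) (vanI m (skewU m)) ≤ spanN m :=
  Ideal.map_le_iff_le_comap.mpr fun _ hG => aeval_kappa_mem_spanN hG

theorem aeval_kappa_mem_spanN_pow {t : ℕ} {G : MvPolynomial (Idx m) ℂ} (hG : G ∈ vanI m (skewU m) ^ t) :
    MvPolynomial.aeval (R := ℂ) (kappa m) G ∈ spanN m ^ t := by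
  have h := Ideal.mem_map_of_mem (MvPolynomial.aeval (R := ℂ) (kappa m)) hG
  rw [Ideal.map_pow] at h
  exact Ideal.pow_right_mono map_kappa_vanI_le t h

/-- `n`-degree as a sum over all `n`-type indices (for additivity). -/
theorem nDeg_eq_univ_sum (α : Idx m →₀ ℕ) :
    nDeg α = ∑ q ∈ (Finset.univ : Finset (Idx m)) with ¬ (ofLex q.2).1 < (ofLex q.2).2, α q := by
  rw [nDeg]
  refine Finset.sum_subset (Finset.filter_subset_filter _ (Finset.subset_univ _)) fun q hq hqs => ?_
  have hq' := Finset.mem_filter.mp hq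
  by_contra h
  exact hqs (Finset.mem_filter.mpr ⟨Finsupp.mem_support_iff.mpr h, hq'.2⟩)

theorem nDeg_add (α β : Idx m →₀ ℕ) : nDeg (α + β) = nDeg α + nDeg β := by
  simp only [nDeg_eq_univ_sum, Finsupp.add_apply, Finset.sum_add_distrib]

/-- Elements of `(n-variables)^t` have all monomials of `n`-degree `≥ t`. -/
theorem le_nDeg_of_mem_spanN_pow {t : ℕ} {G : MvPolynomial (Idx m) ℂ} (hG : G ∈ spanN m ^ t)
    {α : Idx m →₀ ℕ} (hα : α ∈ G.support) : t ≤ nDeg α := by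
  induction t generalizing G α with
  | zero => exact Nat.zero_le _
  | succ t ih =>
    rw [pow_succ] at hG
    -- predicate closed under + and true on products
    have key : ∀ r ∈ spanN m ^ t * spanN m, ∀ α ∈ r.support, t + 1 ≤ nDeg α := by
      intro r hr
      refine Submodule.mul_induction_on hr ?_ ?_
      · intro f hf g hg α hα
        have hsub := MvPolynomial.support_mul f g hα
        obtain ⟨β, hβ, γ, hγ, rfl⟩ := Finset.mem_add.mp hsub
        have h1 : t ≤ nDeg β := ih hf hβ
        have h2 : 1 ≤ nDeg γ := by
          rw [spanN, mem_ideal_span_X_image] at hg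
          obtain ⟨q, hq, hγq⟩ := hg γ hγ
          have hle : γ q ≤ nDeg γ := Finset.single_le_sum (f := fun q => γ q) (fun _ _ => Nat.zero_le _)
            (Finset.mem_filter.mpr ⟨Finsupp.mem_support_iff.mpr hγq, hq⟩)
          have hpos : 0 < γ q := Nat.pos_of_ne_zero hγq
          omega
        rw [nDeg_add]
        omega
      · intro x y hx hy α hα
        rcases Finset.mem_union.mp (MvPolynomial.support_add hα) with h | h
        · exact hx α h
        · exact hy α h
    exact key G hG α hα

/-- The easy half, generalised from §G.1(d): `n`-degrees `≥ s` put `θ G'` into `P_Λ^s`. -/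
theorem aeval_theta_mem_vanI_pow {s : ℕ} {G' : MvPolynomial (Idx m) ℂ} (h : ∀ α ∈ G'.support, s ≤ nDeg α) :
    MvPolynomial.aeval (R := ℂ) (theta m) G' ∈ vanI m (skewU m) ^ s := by
  rw [G'.as_sum, map_sum]
  refine Ideal.sum_mem _ fun α hα => ?_
  rw [aeval_monomial, Finsupp.prod,
    ← Finset.prod_filter_mul_prod_filter_not α.support (fun p => (ofLex p.2).1 < (ofLex p.2).2)]
  refine Ideal.mul_mem_left _ _ (Ideal.mul_mem_left _ _ ?_)
  refine Ideal.pow_le_pow_right (h α hα) ?_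
  rw [nDeg, ← Finset.prod_pow_eq_pow_sum]
  exact Ideal.prod_mem_prod fun p hp => Ideal.pow_mem_pow (theta_mem_vanI (Finset.mem_filter.mp hp).2) _

/-- **`P_Λ^t` in skew/symmetric coordinates**: `G ∈ P_Λ^t` iff every monomial of `κ G` has `n`-degree `≥ t`. -/
theorem mem_vanI_pow_iff_le_nDeg {t : ℕ} {G : MvPolynomial (Idx m) ℂ} :
    G ∈ vanI m (skewU m) ^ t ↔
      ∀ α ∈ (MvPolynomial.aeval (R := ℂ) (kappa m) G).support, t ≤ nDeg α := by
  constructor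
  · intro hG α hα
    exact le_nDeg_of_mem_spanN_pow (aeval_kappa_mem_spanN_pow hG) hα
  · intro h
    rw [← aeval_theta_aeval_kappa G]
    exact aeval_theta_mem_vanI_pow h

/-- **Parity law for the normal order.**  An `H`-invariant form of degree `D` lying in `P_Λ^t` with
`t + D` odd lies in `P_Λ^{t+1}`. -/
theorem mem_vanI_pow_succ_of_odd_add {t D : ℕ} (hpar : Odd (t + D)) {G : MvPolynomial (Idx m) ℂ}
    (hGh : G.IsHomogeneous D) (hGs : G ∈ stabInv m) (hGv : G ∈ vanI m (skewU m) ^ t) :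
    G ∈ vanI m (skewU m) ^ (t + 1) := by
  rw [mem_vanI_pow_iff_le_nDeg] at hGv ⊢
  intro α hα
  have hle := hGv α hα
  have hev := even_nDeg_add_of_mem_support hGh hGs hα
  rcases hle.lt_or_eq with hlt | heq
  · exact hlt
  · exfalso
    rw [← heq] at hev
    exact (Nat.not_even_iff_odd.mpr hpar) hev

/-- **`T_Λ(t+1) = T_Λ(t)` whenever `t + D` is odd** (every `m`, every weight): the valuative filtration of
`Λ_m` jumps only at orders `≡ D (mod 2)`.  §C is `t = 0`, §G.1 is `t = 1`. -/
theorem truncSkew_succ_eq_of_odd_add {t D : ℕ} (hpar : Odd (t + D)) (χ : Weight (MatIdx m)) :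
    truncU m D (skewU m) χ (t + 1) = truncU m D (skewU m) χ t := by
  refine le_antisymm (truncU_anti (Nat.le_succ t)) fun G hG => ?_
  unfold truncU at hG ⊢
  rw [Submodule.mem_inf, Submodule.mem_inf, Submodule.mem_inf] at hG ⊢
  obtain ⟨⟨⟨hGh, hGv⟩, hGs⟩, hGw⟩ := hG
  refine ⟨⟨⟨hGh, ?_⟩, hGs⟩, hGw⟩
  rw [Submodule.restrictScalars_mem] at hGv ⊢
  exact mem_vanI_pow_succ_of_odd_add hpar ((mem_homogeneousSubmodule _ _).mp hGh) hGs hGv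

/-- For the crux with ODD `m` and ODD `δ`: `T(δ) = T(δ - 1)` (the threshold `δ` itself is not a jump). -/
theorem trunc_eq_pred_of_odd {δ : ℕ} (hm : Odd m) (hδ : Odd δ) (lam : Nat.Partition (m * δ)) :
    trunc m δ lam δ = trunc m δ lam (δ - 1) := by
  obtain ⟨k, rfl⟩ := hδ
  have h : 2 * k + 1 - 1 = 2 * k := by omega
  rw [h]
  exact truncSkew_succ_eq_of_odd_add (by
    have : Odd (m * (2 * k + 1)) := hm.mul ⟨k, rfl⟩
    obtain ⟨j, hj⟩ := this
    exact ⟨k + j, by omega⟩) _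

/-- For the crux with EVEN `mδ`: `T(δ + 1) = T(δ)` when `δ` is odd … and in general every odd threshold
is not a jump: `T(2k+2) = T(2k+1)`. -/
theorem trunc_even_degree_odd_threshold {δ k : ℕ} (h : Even (m * δ)) (lam : Nat.Partition (m * δ)) :
    trunc m δ lam (2 * k + 2) = trunc m δ lam (2 * k + 1) :=
  truncSkew_succ_eq_of_odd_add (by obtain ⟨j, hj⟩ := h; exact ⟨k + j, by omega⟩) _

/-- … and for ODD `mδ` every even threshold is not a jump: `T(2k+1) = T(2k)`. -/
theorem trunc_odd_degree_even_threshold {δ k : ℕ} (h : Odd (m * δ)) (lam : Nat.Partition (m * δ)) :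
    trunc m δ lam (2 * k + 1) = trunc m δ lam (2 * k) :=
  truncSkew_succ_eq_of_odd_add (by obtain ⟨j, hj⟩ := h; exact ⟨k + j, by omega⟩) _

end NormalParity

/-! ## §H Stub audit of the three registered lines (gen 3) — no `-- Targets`: no stub is stuck or false

Lines read in full (2026-08-16): `Lines/adjugate-pfaffian-kernel.lean` (7 stubs), `Lines/pencil-degree-frobenius.lean`
(7 stubs), `Lines/pfaffian-square-address.lean` (4 stubs).  Every stub was checked on paper INCLUDING the
degenerate sizes `m = 0, 1, 2` that the `∀ m` stubs quantify over (empty matrix is a unit, `adjugate` of a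
`1 × 1` matrix is `1`, `det` of the empty matrix is `1`, Marcus–Moyls at `m ≤ 1` is `T = c • id`): all 18 are
TRUE as typed.  Exact-arithmetic toy (`toy/check_stubs.py`, item evidence): in the TREE's index conventions
(`tmat M Y = mat(Mᵀ vec Y)`, `linSubst_X`, lex `MatIdx`), for `m = 2, 3` and random unimodular (transposed)
sandwiches: `det (tmat M Y) = det Y`, the cofactor chain rule `tmat Mᵀ (cof (tmat M Y)) = cof Y`
(adjugate stub 2), invariance of `W_m = det(∑ cof X_(k,k))` under the row action (stubs 4 + Frobenius), and the
sparse-point value `W_3 = W_5 = 1` (stub 6) all hold exactly.  The named fact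
`frobenius_detPreserver_unimodular_sandwich` (= pencil stub 4's conclusion = pfaffian stub C) is correctly
stated at `m = 0, 1` too (`P = Q = 1`).  The highest-weight stubs (adjugate 7, pencil 6–7, pfaffian D) match
the tree's conventions: `Weight.IsDominant = Antitone`, and the `B`-semi-invariants of `G ↦ G(g⁻¹A)` have
antitone non-positive weights `χ_j = -(row degree)_j` = `dualOfPartition` (bottom-justified minors; §D is the
one-row certificate).

ERRATUM (information for the adjugate line; the stub itself is unaffected because `Odd m` is a hypothesis):
the docstring of `stub_adjDet_sparsePoint` says "for EVEN `m` no skew matrix has corank one, so `cof ≡ 0` on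
`L_Λ` and the statement is false — `Odd m` is load-bearing here".  This is WRONG: for even `m` a generic skew
`X` is invertible, `cof X = det X · X⁻ᵀ ≠ 0` is again skew, `∑_k cof X_k` is skew of even size and
`W_m|_{L_Λ}` is a Pfaffian SQUARE, non-zero at random skew points (`m = 2`: values `4, 1, 25`; `m = 4`:
`2079364, 5875776, 10575504`).  So `Odd m` is NOT load-bearing for stub 6 either — consistent with §E
(`Odd m` fixes the meaning of the crux, not its truth).  Lean certificate at `m = 2` below
(`adjDetTwo_ne_zero_at_skewPoint`: both slot rows `= J₂`, `W_2 = det(2 J₂) = 4`). -/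

section AdjugateEven

/-- Verbatim copies of the adjugate line's objects at `m = 2` (`cof`, `rowMat`, `slot`, `adjDet`). -/
def cofT {n R : Type*} [Fintype n] [DecidableEq n] [CommRing R] (Y : Matrix n n R) : Matrix n n R :=
  Y.adjugateᵀ

/-- Row `j` of `A` as an `m × m` matrix of coordinate functions. -/
def rowMatX (m : ℕ) (j : MatIdx m) : Matrix (Fin m) (Fin m) (MvPolynomial (Idx m) ℂ) :=
  Matrix.of fun a b => MvPolynomial.X (j, toLex (a, b))

/-- The adjugate line's witness `W_m = det (∑_k cof X_(k,k))` (verbatim shape). -/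
def adjDetW (m : ℕ) : MvPolynomial (Idx m) ℂ :=
  Matrix.det (∑ k : Fin m, cofT (rowMatX m (toLex (k, k))))

/-- `J₂ = [[0,1],[-1,0]]`. -/
def J2 : Matrix (Fin 2) (Fin 2) ℂ := !![0, 1; -1, 0]

/-- The point of `End(ℂ^{2×2})` all of whose rows equal `J₂` (a point of `L_Λ` at the even `m = 2`). -/
def pJ2 : Idx 2 → ℂ := fun q => J2 (ofLex q.2).1 (ofLex q.2).2

theorem pJ2_mem_locus : pJ2 ∈ locus 2 (skewU 2) := by
  intro j
  refine Submodule.subset_span fun a b => ?_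
  fin_cases a <;> fin_cases b <;> simp [pJ2, J2]

/-- **`Odd m` is not load-bearing for the adjugate witness**: at the even `m = 2`, `W_2 ≠ 0` at the skew
point `pJ2` (value `det (2 • J₂) = 4`). -/
theorem adjDetTwo_ne_zero_at_skewPoint : MvPolynomial.eval pJ2 (adjDetW 2) ≠ 0 := by
  have hrow : ∀ k : Fin 2, (MvPolynomial.eval pJ2).mapMatrix (rowMatX 2 (toLex (k, k))) = J2 := by
    intro k
    ext a b
    simp [rowMatX, pJ2]
  have h : MvPolynomial.eval pJ2 (adjDetW 2) = Matrix.det (∑ k : Fin 2, cofT J2) := by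
    rw [adjDetW, RingHom.map_det, map_sum]
    congr 1
    refine Finset.sum_congr rfl fun k _ => ?_
    rw [cofT, cofT, RingHom.mapMatrix_apply, Matrix.transpose_map, ← RingHom.mapMatrix_apply,
      RingHom.map_adjugate, hrow]
  rw [h]
  have hJ : cofT J2 = J2 := by
    ext a b
    fin_cases a <;> fin_cases b <;>
      simp [cofT, J2, Matrix.adjugate_fin_two, Matrix.transpose_apply]
  simp only [hJ, Finset.sum_const, Finset.card_univ, Fintype.card_fin]
  rw [Matrix.det_fin_two]
  simp [J2]

end AdjugateEven

/-! ## §I One-row weights never cut: `T_0((mδ)) = ℂ · det_m(last row)^δ` (tightness of §D)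

§D showed `det_m(last row)^δ ∈ T(0) ∩ T(δ)` at the one-row weight `λ = (mδ)` (odd `m`).  Here the converse:
`T_0((mδ))` is ONE-dimensional, spanned by that element, for every `m ≥ 1` and `δ ≥ 1` — so for odd `m`
the one-row weight is NEVER cut (`T(t) = T(0)` for all `t ≤ δ`), and the strengthening "some one-row weight
is cut" is FALSE.  Mechanism (all elementary, no Frobenius): the torus element `diag(2,…,2,1)` of the Borel
forces a semi-invariant of weight `(mδ)* = -mδ·e_last` to be a polynomial `q` in the LAST ROW only (§I.1);
`H`-invariance of `G` makes `q` invariant under `linSubst M` for every `M ∈ Stab_End(det_m)`, in particular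
under `X ↦ P X`, `det P = 1` (the matrices `Mleft P` lie in the stabiliser by `det (P X) = det X`, §I.2); and an
`SL_m`-invariant form of degree `mδ` on `M_m` is `c · det^δ` (§I.3: `X = P · diag(det X, 1, …, 1)` on the dense
set `det X ≠ 0`, a univariate polynomial `g` with `q = g(det X)` there, `MvPolynomial.funext` after multiplying
by `det`, then homogeneous components).  Consequences §I.4: `trunc_zero_rowPartition_eq_span`,
`finrank_trunc_zero_rowPartition = 1`, `trunc_rowPartition_eq_zero_of_odd`, `not_cutBitesAtOneRowWeight`.
For the route: a flip / cut must live on shapes with at least two rows (consistent with the `m = 3`, `δ = 2`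
toy: `(6)` uncut, `(2,2,2)` cut). -/

section OneRow

/-! ### §I.1 Torus bookkeeping: weight `((mδ))*` means "polynomial in the last row" -/

variable {n : ℕ}

/-- Torus weights: `1` on the last row index, `2` elsewhere. -/
def dTor (n : ℕ) (j : MatIdx (n + 1)) : ℂ := if j = jTop n then 1 else 2

theorem dTor_ne_zero (j : MatIdx (n + 1)) : dTor n j ≠ 0 := by
  unfold dTor; split_ifs <;> norm_num

theorem isUnit_det_diagonal_dTor : IsUnit (Matrix.diagonal (dTor n)).det := by
  rw [Matrix.det_diagonal]
  exact isUnit_iff_ne_zero.mpr (Finset.prod_ne_zero_iff.mpr fun j _ => dTor_ne_zero j)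

/-- The torus element `diag(dTor)` of `GL(MatIdx m)`. -/
def gTor (n : ℕ) : Matrix.GeneralLinearGroup (MatIdx (n + 1)) ℂ :=
  Matrix.nonsingInvUnit (Matrix.diagonal (dTor n)) isUnit_det_diagonal_dTor

theorem coe_gTor : ((gTor n : Matrix.GeneralLinearGroup (MatIdx (n + 1)) ℂ) : Matrix _ _ ℂ)
    = Matrix.diagonal (dTor n) := rfl

theorem coe_gTor_inv : (((gTor n)⁻¹ : Matrix.GeneralLinearGroup (MatIdx (n + 1)) ℂ) : Matrix _ _ ℂ)
    = Matrix.diagonal fun j => (dTor n j)⁻¹ := by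
  rw [Matrix.coe_units_inv, coe_gTor]
  refine Matrix.inv_eq_left_inv ?_
  rw [Matrix.diagonal_mul_diagonal, ← Matrix.diagonal_one]
  congr 1
  funext j
  exact inv_mul_cancel₀ (dTor_ne_zero j)

theorem isUpperTriangular_gTor : IsUpperTriangular (gTor n) :=
  Matrix.blockTriangular_diagonal _

theorem weightChar_chiRow_gTor {δ : ℕ} (hδ : 0 < δ) : weightChar (chiRow n δ) (gTor n) = 1 := by
  rw [weightChar_chiRow hδ, coe_gTor, Matrix.diagonal_apply_eq, dTor, if_pos rfl, one_zpow]

/-- The Borel action of the torus element rescales `X (j, i)` by `(dTor j)⁻¹`. -/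
theorem borelAct_gTor_eq :
    (MvPolynomial.aeval (R := ℂ) fun p : Idx (n + 1) =>
        ∑ l : MatIdx (n + 1), (((gTor n)⁻¹ : Matrix.GeneralLinearGroup (MatIdx (n + 1)) ℂ) :
          Matrix _ _ ℂ) p.1 l • (MvPolynomial.X (l, p.2) : MvPolynomial (Idx (n + 1)) ℂ))
      = MvPolynomial.aeval (R := ℂ) fun p : Idx (n + 1) =>
          (dTor n p.1)⁻¹ • (X p : MvPolynomial (Idx (n + 1)) ℂ) := by
  refine MvPolynomial.algHom_ext fun p => ?_
  rw [aeval_X, aeval_X, coe_gTor_inv]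
  simp only [Matrix.diagonal_apply, ite_smul, zero_smul, Finset.sum_ite_eq, Finset.mem_univ, if_true]

/-- **A semi-invariant of the one-row weight `((mδ))*` is a polynomial in the LAST row.** -/
theorem vars_subset_lastRow {δ : ℕ} (hδ : 0 < δ) {G : MvPolynomial (Idx (n + 1)) ℂ}
    (hG : G ∈ hwSp (n + 1) (chiRow n δ)) :
    (↑G.vars : Set (Idx (n + 1))) ⊆ Set.range (fun i : MatIdx (n + 1) => (jTop n, i)) := by
  intro p hp
  rw [Finset.mem_coe, mem_vars_iff_mem_support] at hp
  obtain ⟨α, hα, hpα⟩ := hp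
  have hinv : MvPolynomial.aeval (R := ℂ)
      (fun p : Idx (n + 1) => (dTor n p.1)⁻¹ • (X p : MvPolynomial (Idx (n + 1)) ℂ)) G = G := by
    have h := (mem_hwSp_iff.mp hG) (gTor n) isUpperTriangular_gTor
    rw [borelAct_gTor_eq, weightChar_chiRow_gTor hδ, one_smul] at h
    exact h
  have hw := prod_eq_one_of_invariant hinv hα
  rw [← Finset.prod_filter_mul_prod_filter_not α.support (fun q => q.1 = jTop n),
    Finset.prod_eq_one (fun q hq => by rw [dTor, if_pos (Finset.mem_filter.mp hq).2, inv_one, one_pow]),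
    one_mul] at hw
  have hw' : ∏ q ∈ α.support with ¬ q.1 = jTop n, ((2 : ℂ)⁻¹) ^ α q = 1 := by
    rw [← hw]
    exact Finset.prod_congr rfl fun q hq => by rw [dTor, if_neg (Finset.mem_filter.mp hq).2]
  rw [Finset.prod_pow_eq_pow_sum] at hw'
  have he : (∑ q ∈ α.support with ¬ q.1 = jTop n, α q) = 0 := by
    rw [inv_pow, inv_eq_one] at hw'
    have h2 : (2 : ℕ) ^ (∑ q ∈ α.support with ¬ q.1 = jTop n, α q) = 1 := by exact_mod_cast hw'
    exact (Nat.pow_eq_one.mp h2).resolve_left (by norm_num)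
  by_cases hp1 : p.1 = jTop n
  · exact ⟨p.2, by rw [← hp1]⟩
  · exfalso
    have hle : α p ≤ ∑ q ∈ α.support with ¬ q.1 = jTop n, α q :=
      Finset.single_le_sum (f := fun q => α q) (fun _ _ => Nat.zero_le _) (Finset.mem_filter.mpr ⟨hpα, hp1⟩)
    have hpos : 0 < α p := Nat.pos_of_ne_zero (Finsupp.mem_support_iff.mp hpα)
    omega

theorem exists_rename_lastRow {δ : ℕ} (hδ : 0 < δ) {G : MvPolynomial (Idx (n + 1)) ℂ}
    (hG : G ∈ hwSp (n + 1) (chiRow n δ)) :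
    ∃ q : MvPolynomial (MatIdx (n + 1)) ℂ, rename (fun i : MatIdx (n + 1) => (jTop n, i)) q = G :=
  exists_rename_eq_of_vars_subset_range G _ (Prod.mk_right_injective _) (vars_subset_lastRow hδ hG)

/-! ### §I.2 `H`-invariance descends to the row polynomial; left multiplications lie in `Stab_End(det_m)` -/

/-- A row polynomial whose `rename` is `H`-invariant is `linSubst`-invariant under the stabiliser. -/
theorem linSubst_eq_of_rename_mem_stabInv {m : ℕ} {q : MvPolynomial (MatIdx m) ℂ} {j : MatIdx m}
    (hG : rename (fun i : MatIdx m => (j, i)) q ∈ stabInv m) (M : Matrix (MatIdx m) (MatIdx m) ℂ)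
    (hM : linSubst (MatIdx m) ℂ M (detFormLex ℂ m) = detFormLex ℂ m) :
    linSubst (MatIdx m) ℂ M q = q := by
  have h := (mem_stabInv_iff.mp hG) M hM
  rw [aeval_rowAct_rename] at h
  exact rename_injective _ (Prod.mk_right_injective j) h

/-- The matrix of `X ↦ P X` on `ℂ^{m×m}` in the `linSubst` convention. -/
def Mleft {m : ℕ} (P : Matrix (Fin m) (Fin m) ℂ) : Matrix (MatIdx m) (MatIdx m) ℂ :=
  Matrix.of fun l i => if (ofLex l).2 = (ofLex i).2 then P (ofLex i).1 (ofLex l).1 else 0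

theorem linSubst_Mleft_X {m : ℕ} (P : Matrix (Fin m) (Fin m) ℂ) (a b : Fin m) :
    linSubst (MatIdx m) ℂ (Mleft P) (X (toLex (a, b)))
      = ∑ c : Fin m, P a c • (X (toLex (c, b)) : MvPolynomial (MatIdx m) ℂ) := by
  rw [linSubst_X, ← Equiv.sum_comp (toLex : Fin m × Fin m ≃ MatIdx m), Fintype.sum_prod_type]
  refine Finset.sum_congr rfl fun c _ => ?_
  simp only [Mleft, Matrix.of_apply, ofLex_toLex, ite_smul, zero_smul, Finset.sum_ite_eq',
    Finset.mem_univ, if_true]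

/-- The generic matrix in the lexicographic variables. -/
def genLex (m : ℕ) : Matrix (Fin m) (Fin m) (MvPolynomial (MatIdx m) ℂ) :=
  Matrix.of fun a b => X (toLex (a, b))

theorem detFormLex_eq_det_genLex (m : ℕ) : detFormLex ℂ m = (genLex m).det := by
  rw [detFormLex, detPoly, AlgHom.map_det]
  congr 1
  ext a b
  simp [Matrix.mvPolynomialX, rename_X, genLex]

theorem mapMatrix_linSubst_Mleft_genLex {m : ℕ} (P : Matrix (Fin m) (Fin m) ℂ) :
    (linSubst (MatIdx m) ℂ (Mleft P)).mapMatrix (genLex m)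
      = P.map (C : ℂ →+* MvPolynomial (MatIdx m) ℂ) * genLex m := by
  ext a b
  rw [AlgHom.mapMatrix_apply, Matrix.map_apply, genLex, Matrix.of_apply, linSubst_Mleft_X, Matrix.mul_apply]
  simp [smul_eq_C_mul]

/-- **`Mleft P ∈ Stab_End(det_m)` for `det P = 1`**: `det (P X) = det X`. -/
theorem linSubst_Mleft_detFormLex {m : ℕ} (P : Matrix (Fin m) (Fin m) ℂ) (hP : P.det = 1) :
    linSubst (MatIdx m) ℂ (Mleft P) (detFormLex ℂ m) = detFormLex ℂ m := by
  rw [detFormLex_eq_det_genLex, AlgHom.map_det, mapMatrix_linSubst_Mleft_genLex, Matrix.det_mul,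
    ← RingHom.mapMatrix_apply, ← RingHom.map_det, hP, map_one, one_mul]

/-! ### §I.3 `SL_m`-invariant forms of degree `mδ` are multiples of `det^δ` -/

/-- `mat x`: the coordinate vector `x` as an `m × m` matrix. -/
def matOf {m : ℕ} (x : MatIdx m → ℂ) : Matrix (Fin m) (Fin m) ℂ := Matrix.of fun a b => x (toLex (a, b))

/-- `vec Y`: the matrix `Y` as a coordinate vector. -/
def vecOf {m : ℕ} (Y : Matrix (Fin m) (Fin m) ℂ) : MatIdx m → ℂ := fun i => Y (ofLex i).1 (ofLex i).2

theorem matOf_vecOf {m : ℕ} (Y : Matrix (Fin m) (Fin m) ℂ) : matOf (vecOf Y) = Y := by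
  ext a b; simp [matOf, vecOf]

theorem vecOf_matOf {m : ℕ} (x : MatIdx m → ℂ) : vecOf (matOf x) = x := by
  funext i; simp [matOf, vecOf]

theorem eval_detFormLex {m : ℕ} (x : MatIdx m → ℂ) : MvPolynomial.eval x (detFormLex ℂ m) = (matOf x).det := by
  rw [detFormLex_eq_det_genLex, RingHom.map_det]
  congr 1
  ext a b
  simp [genLex, matOf]

/-- Evaluating `linSubst (Mleft P) q` at `x` evaluates `q` at `P · mat x`. -/
theorem eval_linSubst_Mleft {m : ℕ} (P : Matrix (Fin m) (Fin m) ℂ) (q : MvPolynomial (MatIdx m) ℂ)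
    (x : MatIdx m → ℂ) :
    MvPolynomial.eval x (linSubst (MatIdx m) ℂ (Mleft P) q) = MvPolynomial.eval (vecOf (P * matOf x)) q := by
  have hcomp := AlgHom.congr_fun
    (MvPolynomial.comp_aeval (fun i : MatIdx m => ∑ j, Mleft P j i • (X j : MvPolynomial (MatIdx m) ℂ))
      (MvPolynomial.aeval (R := ℂ) x)) q
  rw [AlgHom.comp_apply] at hcomp
  have hpt : (fun i : MatIdx m => MvPolynomial.aeval (R := ℂ) x
      (∑ j, Mleft P j i • (X j : MvPolynomial (MatIdx m) ℂ))) = vecOf (P * matOf x) := by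
    funext i
    have hli : (∑ j, Mleft P j i • (X j : MvPolynomial (MatIdx m) ℂ))
        = linSubst (MatIdx m) ℂ (Mleft P) (X (toLex ((ofLex i).1, (ofLex i).2))) := by
      rw [linSubst_X]; rfl
    rw [hli, linSubst_Mleft_X, map_sum]
    simp only [map_smul, aeval_X, smul_eq_mul, vecOf, Matrix.mul_apply, matOf, Matrix.of_apply]
  have h1 : MvPolynomial.eval x (linSubst (MatIdx m) ℂ (Mleft P) q)
      = MvPolynomial.aeval (R := ℂ) x (linSubst (MatIdx m) ℂ (Mleft P) q) := rfl
  rw [h1, linSubst, hcomp, hpt]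
  rfl

/-- `diag(d, 1, …, 1)`. -/
def Ddiag {m : ℕ} (i₀ : Fin m) (d : ℂ) : Matrix (Fin m) (Fin m) ℂ :=
  Matrix.diagonal (Function.update (fun _ => (1 : ℂ)) i₀ d)

theorem det_Ddiag {m : ℕ} (i₀ : Fin m) (d : ℂ) : (Ddiag i₀ d).det = d := by
  rw [Ddiag, Matrix.det_diagonal, Finset.prod_update_of_mem (Finset.mem_univ _)]
  simp

/-- The univariate restriction `g(u) = q(diag(u, 1, …, 1))`. -/
def gRes {m : ℕ} (i₀ : Fin m) (q : MvPolynomial (MatIdx m) ℂ) : Polynomial ℂ :=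
  MvPolynomial.aeval (R := ℂ) (fun i : MatIdx m =>
    if (ofLex i).1 = (ofLex i).2 then (if (ofLex i).1 = i₀ then Polynomial.X else 1) else 0) q

theorem eval_gRes {m : ℕ} (i₀ : Fin m) (q : MvPolynomial (MatIdx m) ℂ) (d : ℂ) :
    (gRes i₀ q).eval d = MvPolynomial.eval (vecOf (Ddiag i₀ d)) q := by
  rw [gRes, ← Polynomial.coe_aeval_eq_eval]
  have hcomp := AlgHom.congr_fun (MvPolynomial.comp_aeval (R := ℂ)
    (fun i : MatIdx m => if (ofLex i).1 = (ofLex i).2 then (if (ofLex i).1 = i₀ then Polynomial.X else 1) else 0)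
    (Polynomial.aeval (R := ℂ) d)) q
  rw [AlgHom.comp_apply] at hcomp
  rw [hcomp]
  have hpt : (fun i : MatIdx m => Polynomial.aeval (R := ℂ) d
      (if (ofLex i).1 = (ofLex i).2 then (if (ofLex i).1 = i₀ then (Polynomial.X : Polynomial ℂ) else 1) else 0))
      = vecOf (Ddiag i₀ d) := by
    funext i
    simp only [vecOf, Ddiag, Matrix.diagonal_apply, Function.update_apply]
    split_ifs with h1 h2 <;> simp_all
  rw [hpt]
  rfl

/-- **`SL_m`-invariants.**  A form of degree `mδ` on `M_m` (`m ≥ 1`) invariant under `X ↦ P X` for all `P`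
with `det P = 1` is a scalar multiple of `det^δ`. -/
theorem eq_C_mul_detFormLex_pow {m δ : ℕ} (hm : 0 < m) {q : MvPolynomial (MatIdx m) ℂ}
    (hqh : q.IsHomogeneous (m * δ))
    (hqinv : ∀ P : Matrix (Fin m) (Fin m) ℂ, P.det = 1 → linSubst (MatIdx m) ℂ (Mleft P) q = q) :
    ∃ c : ℂ, q = C c * detFormLex ℂ m ^ δ := by
  set i₀ : Fin m := ⟨0, hm⟩
  set g := gRes i₀ q with hg
  -- (a) on `det X ≠ 0`, `q(X) = g(det X)`
  have ha : ∀ x : MatIdx m → ℂ, (matOf x).det ≠ 0 → MvPolynomial.eval x q = g.eval (matOf x).det := by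
    intro x hx
    set d := (matOf x).det
    have hDunit : IsUnit (Ddiag i₀ d).det := by rw [det_Ddiag]; exact isUnit_iff_ne_zero.mpr hx
    set P := matOf x * (Ddiag i₀ d)⁻¹ with hP
    have hPdet : P.det = 1 := by
      rw [hP, Matrix.det_mul, Matrix.det_nonsing_inv, det_Ddiag, Ring.inverse_eq_inv, mul_inv_cancel₀ hx]
    have hPD : P * Ddiag i₀ d = matOf x := Matrix.nonsing_inv_mul_cancel_right _ _ hDunit
    have h := congrArg (MvPolynomial.eval (vecOf (Ddiag i₀ d))) (hqinv P hPdet)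
    rw [eval_linSubst_Mleft, matOf_vecOf, hPD, vecOf_matOf] at h
    rw [h, eval_gRes]
  -- (b) hence `(q - g(det)) · det = 0`, so `q = g(det)`
  have hb : q = Polynomial.aeval (detFormLex ℂ m) g := by
    have hzero : (q - Polynomial.aeval (detFormLex ℂ m) g) * detFormLex ℂ m = 0 := by
      refine MvPolynomial.funext fun x => ?_
      rw [map_mul, map_zero, eval_detFormLex]
      by_cases hx : (matOf x).det = 0
      · rw [hx, mul_zero]
      · rw [map_sub, ha x hx]
        have : MvPolynomial.eval x (Polynomial.aeval (detFormLex ℂ m) g) = g.eval (matOf x).det := by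
          have h := Polynomial.aeval_algHom_apply (MvPolynomial.aeval (R := ℂ) x) (detFormLex ℂ m) g
          rw [Polynomial.coe_aeval_eq_eval] at h
          change MvPolynomial.aeval (R := ℂ) x (Polynomial.aeval (detFormLex ℂ m) g) = _
          rw [← h]
          congr 1
          exact eval_detFormLex x
        rw [this, sub_self, zero_mul]
    rcases mul_eq_zero.mp hzero with h | h
    · exact sub_eq_zero.mp h
    · exact absurd h (detFormLex_ne_zero m)
  -- (c) homogeneous components: only `det^δ` survives
  refine ⟨g.coeff δ, ?_⟩
  have hcomp := congrArg (MvPolynomial.homogeneousComponent (m * δ)) hb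
  rw [homogeneousComponent_of_mem ((mem_homogeneousSubmodule _ _).mpr hqh), if_pos rfl] at hcomp
  rw [hcomp, Polynomial.aeval_eq_sum_range, map_sum]
  have hk : ∀ k : ℕ, MvPolynomial.homogeneousComponent (m * δ) (g.coeff k • detFormLex ℂ m ^ k)
      = if k = δ then C (g.coeff δ) * detFormLex ℂ m ^ δ else 0 := by
    intro k
    rw [map_smul, homogeneousComponent_of_mem ((mem_homogeneousSubmodule _ _).mpr
      ((detFormLex_isHomogeneous ℂ m).pow k))]
    by_cases hkδ : k = δ
    · subst hkδ; rw [if_pos rfl, if_pos rfl, smul_eq_C_mul]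
    · rw [if_neg hkδ, if_neg (fun h => hkδ (Nat.eq_of_mul_eq_mul_left hm h).symm), smul_zero]
  simp only [hk, Finset.sum_ite_eq', Finset.mem_range]
  by_cases hδ : δ < g.natDegree + 1
  · rw [if_pos hδ]
  · rw [if_neg hδ, Polynomial.coeff_eq_zero_of_natDegree_lt (by omega), map_zero, zero_mul]

/-! ### §I.4 Consequences for the crux at the one-row weight -/

/-- `T_0((mδ)) ≤ ℂ · det_m(last row)^δ`. -/
theorem trunc_zero_rowPartition_le_span {δ : ℕ} (hδ : 0 < δ) :
    trunc (n + 1) δ (rowPartition ((n + 1) * δ)) 0 ≤ ℂ ∙ (detRow (n + 1) (jTop n) ^ δ) := by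
  intro G hG
  rw [trunc, truncU_zero, Submodule.mem_inf, Submodule.mem_inf] at hG
  obtain ⟨⟨hGh, hGs⟩, hGw⟩ := hG
  obtain ⟨q, rfl⟩ := exists_rename_lastRow hδ hGw
  have hqh : q.IsHomogeneous ((n + 1) * δ) :=
    (IsHomogeneous.rename_isHomogeneous_iff (Prod.mk_right_injective _)).mp
      ((mem_homogeneousSubmodule _ _).mp hGh)
  have hqinv : ∀ P : Matrix (Fin (n + 1)) (Fin (n + 1)) ℂ, P.det = 1 →
      linSubst (MatIdx (n + 1)) ℂ (Mleft P) q = q := fun P hP =>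
    linSubst_eq_of_rename_mem_stabInv hGs (Mleft P) (linSubst_Mleft_detFormLex P hP)
  obtain ⟨c, hc⟩ := eq_C_mul_detFormLex_pow (Nat.succ_pos n) hqh hqinv
  rw [Submodule.mem_span_singleton]
  refine ⟨c, ?_⟩
  rw [hc, map_mul, rename_C, map_pow, detRow, smul_eq_C_mul]

/-- **`T_0((mδ)) = ℂ · det_m(last row)^δ`** for every `m ≥ 1`, `δ ≥ 1`. -/
theorem trunc_zero_rowPartition_eq_span {δ : ℕ} (hδ : 0 < δ) :
    trunc (n + 1) δ (rowPartition ((n + 1) * δ)) 0 = ℂ ∙ (detRow (n + 1) (jTop n) ^ δ) :=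
  le_antisymm (trunc_zero_rowPartition_le_span hδ)
    ((Submodule.span_singleton_le_iff_mem _ _).mpr (detRow_pow_mem_trunc_zero hδ))

/-- **`dim T_0((mδ)) = 1`** (the first exact dimension of a truncation space): every `m ≥ 1`, `δ ≥ 1`. -/
theorem finrank_trunc_zero_rowPartition {δ : ℕ} (hδ : 0 < δ) :
    Module.finrank ℂ ↥(trunc (n + 1) δ (rowPartition ((n + 1) * δ)) 0) = 1 := by
  rw [trunc_zero_rowPartition_eq_span hδ]
  exact finrank_span_singleton (pow_ne_zero δ (detRow_ne_zero _))

/-- **One-row weights never cut (odd `m`).**  `T(t) = T(0)` at `λ = (mδ)` for every `t ≤ δ`. -/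
theorem trunc_rowPartition_eq_zero_of_odd (hm : Odd (n + 1)) {δ : ℕ} (hδ : 0 < δ) {t : ℕ} (ht : t ≤ δ) :
    trunc (n + 1) δ (rowPartition ((n + 1) * δ)) t = trunc (n + 1) δ (rowPartition ((n + 1) * δ)) 0 := by
  refine le_antisymm (truncU_le_zero t) fun G hG => ?_
  have hG' := trunc_zero_rowPartition_le_span hδ hG
  rw [Submodule.mem_span_singleton] at hG'
  obtain ⟨c, rfl⟩ := hG'
  exact Submodule.smul_mem _ c (truncU_anti ht (detRow_pow_mem_trunc_delta_of_odd hm hδ))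

/-- The strengthening "for every odd `m ≥ 3` some ONE-ROW weight `(mδ)` is cut". -/
def CutBitesAtOneRowWeight : Prop :=
  ∀ m : ℕ, Odd m → 3 ≤ m → ∃ δ : ℕ,
    Module.finrank ℂ ↥(trunc m δ (rowPartition (m * δ)) δ)
      < Module.finrank ℂ ↥(trunc m δ (rowPartition (m * δ)) 0)

/-- **Refuted strengthening.**  No one-row weight is ever cut for odd `m` (witness `m = 3`; every odd `m`,
every `δ` by `trunc_rowPartition_eq_zero_of_odd`; `δ = 0` is trivial). -/
theorem not_cutBitesAtOneRowWeight : ¬ CutBitesAtOneRowWeight := by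
  intro h
  obtain ⟨δ, hlt⟩ := h (2 + 1) (by decide) le_rfl
  rcases Nat.eq_zero_or_pos δ with hδ | hδ
  · subst hδ
    exact lt_irrefl _ hlt
  · rw [trunc_rowPartition_eq_zero_of_odd (n := 2) (by decide) hδ le_rfl] at hlt
    exact lt_irrefl _ hlt

/-! ### §I.5 Contrast: for EVEN `m` the one-row weight is TOTALLY cut

At the even `m = 4` (§E's point `pJ`, all rows `J₄`): `T(t) = ⊥` for every `t ≥ 1` at `λ = (4δ)`, while
`finrank T(0) = 1` — the one-row weight is cut for even `m` and never cut for odd `m` (§I.4): the truth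
table of the crux's conclusion at the one-row weight is exactly the parity of `m`. -/

theorem trunc_rowPartition_eq_bot_at_four {δ : ℕ} (hδ : 0 < δ) {t : ℕ} (ht : 0 < t) :
    trunc (3 + 1) δ (rowPartition ((3 + 1) * δ)) t = ⊥ := by
  rw [Submodule.eq_bot_iff]
  intro G hG
  have hG0 : G ∈ trunc (3 + 1) δ (rowPartition ((3 + 1) * δ)) 0 := truncU_le_zero t hG
  have hG' := trunc_zero_rowPartition_le_span hδ hG0
  rw [Submodule.mem_span_singleton] at hG'
  obtain ⟨c, rfl⟩ := hG'
  have hev := eval_eq_zero_of_mem_truncU ht hG pJ_mem_locus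
  rw [MvPolynomial.smul_eval, map_pow] at hev
  rcases mul_eq_zero.mp hev with hc | hp
  · rw [hc, zero_smul]
  · exact absurd ((pow_eq_zero_iff hδ.ne').mp hp) (eval_pJ_detRow_ne_zero _)

/-- For even `m = 4`: `finrank T(t) = 0 < 1 = finrank T(0)` at `λ = (4δ)`, every `δ, t ≥ 1`. -/
theorem finrank_trunc_rowPartition_lt_at_four {δ : ℕ} (hδ : 0 < δ) {t : ℕ} (ht : 0 < t) :
    Module.finrank ℂ ↥(trunc (3 + 1) δ (rowPartition ((3 + 1) * δ)) t)
      < Module.finrank ℂ ↥(trunc (3 + 1) δ (rowPartition ((3 + 1) * δ)) 0) := by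
  rw [trunc_rowPartition_eq_bot_at_four hδ ht, finrank_bot, finrank_trunc_zero_rowPartition hδ]
  exact Nat.zero_lt_one

/-! ### §I.6 Remark (paper + toy, not formalised): TWO-row weights are never cut either; the cut index is `3`

Generalising §I.1, a semi-invariant whose weight is supported on the last `k` lex indices is a polynomial in
the last `k` ROWS (torus `diag(2,…,2,1,…,1)`), and `H`-invariance makes it an invariant `q(X_1,…,X_k)` of
`k`-tuples of `m × m` matrices under the simultaneous left–right action of `SL_m × SL_m` (`Mleft P`, and
symmetrically right multiplications, lie in `Stab_End(det_m)`).  For `k = 2` the invariants of PAIRS are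
generated by the coefficients of `det(sX + tY)` (blow-ups `det(T_1 ⊗ X + T_2 ⊗ Y)` factor through Jordan
blocks of `T_1⁻¹T_2` into products of `det(X + λY)`; Derksen–Makam 2017 for generation by blow-ups), and
ALL of these vanish on skew pairs when `m` is odd (`det` of an odd skew pencil is `0`; equivalently: a
singular pencil is a compression space, so a skew pair lies in the null cone).  Hence for odd `m` NO weight
`λ` with `≤ 2` parts is ever cut (`T(1) = T(0)` there), for any `δ`: the first cut lives on `3`-row shapes —
and `3` rows suffice for every odd `m ≥ 3` (the symmetric `2 × 2` blow-up `(E₁₁, σ_x, E₂₂)` at the skew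
triple `(J, K, J')` is the non-singular `Z_m` of the pencil line; at `m = 3` the cut shape is `(2,2,2)`,
card toy).  Toy `toy/check_pairs_nullcone.py` (exact): for `m = 3, 5` and blow-up sizes `d = 2, 3`, random
`det(T_1 ⊗ S_1 + T_2 ⊗ S_2)` on skew PAIRS is always `0`, on skew TRIPLES non-zero `6/6`.  So the crux's
`∃ λ` necessarily has `λ.parts.card ≥ 3` (odd `m`); informative for `ValuativeFlip`: Kadish–Landsberg-type
shapes with few rows are invisible to the `Λ_m`-cut.  (Formalising the `k = 2` statement needs the
generation theorem for pair invariants — out of scope; §I is the `k = 1` case in Lean.) -/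

end OneRow

end

end Summit.ValiantsHypothesis.ValiantsHypothesis.Cruxes.CutBites.Disproof
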